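import Mathlib.LinearAlgebra.Matrix.Rank
import Mathlib.RingTheory.RootsOfUnity.PrimitiveRoots
import Literature.NumberTheory.Transcendental.GammaFields
import Literature.NumberTheory.Transcendental.GammaFieldsEcl
import Literature.NumberTheory.Transcendental.ZilberSaturation
import Literature.NumberTheory.Transcendental.ZilberField
import Literature.NumberTheory.Transcendental.ZilberGenericClosedness
import Literature.NumberTheory.Transcendental.ZilberFieldHomogeneity
import Literature.FieldTheory.Kummer.DivisionSequences
import Literature.NumberTheory.Transcendental.LocusComponents
import Literature.NumberTheory.Transcendental.GammaIsoTransfer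
import Literature.NumberTheory.Transcendental.GammaPointsDense
import HarnessLib

/-!
# `ℵ₀`-saturation of Zilber fields for Γ-algebraic extensions: the main case (Bays–Kirby 2018, Lemma 8.3)

This file proves the core of Bays–Kirby 2018, Lemma 8.3 (⟹) — strong exponential-algebraic
closedness (axiom 4) makes a pseudo-exponential field `ℵ₀`-saturated for finitely generated
Γ-algebraic strong extensions — for the extensions `A ◁ B` to which the printed proof reduces
("so we may assume `A = A^full ∧ B`"), granted the Kummer-theoretic named fact
`Literature.FieldTheory.Kummer.BaysKirby2018_divisionSequences_determined` (Prop. 3.22/3.24: existence of good bases):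

* `Literature.NumberTheory.Transcendental.ZilberSaturationMain.exists_isGammaIso_append_of_free` — let `F` be algebraically closed
  and strongly exponentially-algebraically closed with `ker exp = τℤ`, `ℚτ + ℚc ◁ F`,
  `ℚτ + ℚc' ◁ F`, `c ↦ c'` a Γ-isomorphism over `ℚτ` (`GammaField.IsGammaIso`), and `e` a tuple
  linearly independent over `X = ℚτ + ℚc` with `td(e/X) = k` (a basis of a Γ-algebraic extension
  `B = ⟨X, e⟩` of `A = ⟨X⟩`) which is *free*: no non-trivial `ℤ`-combination of `e`, nor its
  exponential, is algebraic over `ℚ(Γ(X))` — this is the condition `A^full ∧ B = A` of the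
  source, in the form in which Cor. 7.4 uses it. Then there is `e'` with `(c, e) ↦ (c', e')` a
  Γ-isomorphism over `ℚτ` and `ℚτ + ℚc' + ℚe' ◁ F`.

The proof follows the source (p. 26) step by step, inside `F`:

1. *(good basis)* by the Kummer fact applied to `(exp u, exp e)` (`u` a basis of `X` over `ℚτ`;
   multiplicative independence modulo roots of unity comes from `ker exp = τℤ` and linear
   independence, `mulIndepModTorsion_exp`) there is `m` such that the `m`-th division point
   `a = e/m` is good;
2. *(the variety)* the locus `loc((a, exp a)/A)` (`locusIdeal`, a prime of `A[X, Y]`,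
   `A = ⟨ℚτ, c⟩ = K₀(allGens c)`) has transcendence degree `k` (`δ = 0`), and freeness and
   rotundity data over `A` ("`V` is free and rotund by Cor. 7.4", here from strongness of `X`:
   `exists_algebraicIndependent_matrixAct`, Prop. 7.3's `td(M·b/A) ≥ rk M`); it is transported
   along the Γ-isomorphism `θ : A ≅ A'` and an absolutely irreducible component `W = Z(Q)` of its
   base change to `F` is taken (`LocusComponents.lean`: dimension, rotundity, freeness of `W`);
3. *(axiom 4)* Kirby's linear-independence scheme (`IsStronglyExpAlgClosed.isLinIndepExpAlgClosed`)
   gives `(x, exp x) ∈ W` with `x` linearly independent over `X' = ℚτ + ℚc'`; since `X' ◁ F`,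
   `td(x/X') ≥ k = dim W`, so `(x, exp x)` is generic in `θ(loc)` over `A'`
   (`exists_generic_partner`; "thus `c` is generic in `V` over `A`");
4. *(good basis ⟹ isomorphism)* genericity gives a field embedding `ι : A((a, exp a)) → F` over
   `θ` with `(a, exp a) ↦ (x, exp x)`; the division systems `exp (a/q)` and `exp (x/q)` below
   `exp a` and `exp x = ι (exp a)` have the same ideal over `A(a, exp a) ⊇ L` by the Kummer fact
   (instantiated at the `L`-algebra structure `ι` on `F`, `Twisted`), whence a ring homomorphism
   `L(exp (a/q) : q) → F` over `ι` (`GammaField.pointFieldHom` of `GammaIsoTransfer.lean`) which is an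
   embedding of the Γ-field `⟨X, e⟩` extending `θ` (`exists_ringHom_isoCore`), i.e. a
   Γ-isomorphism `(c, e) ↦ (c', m x)` (`GammaField.isGammaIso_of_ringHom`); strongness of
   `X' + ℚx` is Lemma 4.8 (`δ = 0` over the strong `X'`).

The reduction of the general Γ-algebraic strong extension to the free case (the full-closure step
"`A^full ∧ B` embeds strongly into `F`", via the absorption of algebraic elements and of
logarithms, Kirby 2013 Thm 2.18) and the assembly of
`Literature.NumberTheory.Transcendental.BaysKirby2018_saturation_of_isStronglyExpAlgClosed` are carried out in a sequel.

## Main intermediate results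

* `ldim_span_rows_eq_rank`, `exists_linIndepOver_comp` — linear algebra modulo a subspace;
* `isPrimitiveRoot_exp_div`, `allRoots_exp_subset`, `mulIndepModTorsion_exp` — roots of unity
  and roots of exponentials when `ker exp = τℤ`;
* `exists_algebraicIndependent_of_le_relRank`, `toENat_trdeg_algebra_adjoin_eq_relRank` —
  bridges between the algebraic matroid of `F/ℚ` (the currency of `GammaFields.lean`) and
  `Algebra.trdeg` / `AlgebraicIndependent` over a subfield (the currency of `ExpVarieties.lean`);
* `exists_algebraicIndependent_matrixAct`, `relRank_range_gammaPt`,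
  `ringKrullDim_coordRing_locusIdeal_eq` — the locus data;
* `exists_generic_partner` — steps 2–3;
* `exists_ringHom_isoCore` — step 4 (the field embedding is `GammaField.pointFieldHom`).

## References

* M. Bays, J. Kirby, *Pseudo-exponential maps, variants, and quasiminimality*, Algebra & Number
  Theory 12 (2018) 493–549: Def. 3.19, Prop. 3.22, Lemma 4.8, Prop. 7.3, Cor. 7.4, Lemma 8.3.
* J. Kirby, *Finitely presented exponential fields*, Algebra & Number Theory 7 (2013), Thm 2.18.
* J. Kirby, *A note on the axioms for Zilber's pseudo-exponential fields*, NDJFL 54 (2013), §2.3.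
-/

noncomputable section

open Set MvPolynomial

universe u

namespace Literature.NumberTheory.Transcendental

namespace ZilberSaturationMain

open GammaField Literature.ModelTheory.ExponentialFields.ExponentialRing

/-! ### Linear algebra modulo a subspace -/

section LinAlg

variable {F : Type*} [Field F] [CharZero F]

/-- Linear independence over `Λ` passes to non-zero rational rescalings. [folklore] -/
theorem _root_.Literature.NumberTheory.Transcendental.GammaField.LinIndepOver.smul {Λ : Submodule ℚ F} {k : ℕ} {e : Fin k → F} (h : LinIndepOver Λ e)
    {q : ℚ} (hq : q ≠ 0) : LinIndepOver Λ (fun j => q • e j) := by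
  intro r hr
  have h' : ∑ i, (r i * q) • e i ∈ Λ := by
    simpa [mul_smul] using hr
  have := h _ h'
  funext i
  have hi := congrFun this i
  simp only [Pi.zero_apply, mul_eq_zero] at hi
  exact hi.resolve_right hq

/-- A sub-tuple relation: if `e` is linearly independent over `Λ` then no non-zero `ℤ`-combination
of the `eⱼ` lies in `Λ`. [folklore] -/
theorem _root_.Literature.NumberTheory.Transcendental.GammaField.LinIndepOver.sum_intCast_smul_notMem {Λ : Submodule ℚ F} {k : ℕ} {e : Fin k → F}
    (h : LinIndepOver Λ e) {m : Fin k → ℤ} (hm : m ≠ 0) : ∑ j, (m j : ℚ) • e j ∉ Λ := by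
  intro hmem
  apply hm
  have := h (fun j => (m j : ℚ)) hmem
  funext j
  have hj : ((m j : ℤ) : ℚ) = 0 := congrFun this j
  rw [Pi.zero_apply]
  exact_mod_cast hj

/-- Joint linear independence: `u` independent over `Λ` and `e` independent over `Λ + ℚu` give
`(u, e)` independent over `Λ`. [folklore] -/
theorem _root_.Literature.NumberTheory.Transcendental.GammaField.LinIndepOver.append {Λ : Submodule ℚ F} {r k : ℕ} {u : Fin r → F} {e : Fin k → F}
    (hu : LinIndepOver Λ u) (he : LinIndepOver (Λ ⊔ Submodule.span ℚ (range u)) e) :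
    LinIndepOver Λ (Fin.append u e) := by
  intro q hq
  rw [Fin.sum_univ_add] at hq
  simp only [Fin.append_left, Fin.append_right] at hq
  -- the `e`-part lies in `Λ + ℚu`, so its coefficients vanish
  have he0 : (fun j => q (Fin.natAdd r j)) = 0 := by
    apply he
    have : ∑ j, q (Fin.natAdd r j) • e j =
        (∑ i, q (Fin.castAdd k i) • u i + ∑ j, q (Fin.natAdd r j) • e j) -
          ∑ i, q (Fin.castAdd k i) • u i := by abel
    rw [this]
    refine Submodule.sub_mem _ (Submodule.mem_sup_left hq) (Submodule.mem_sup_right ?_)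
    exact Submodule.sum_mem _ fun i _ =>
      Submodule.smul_mem _ _ (Submodule.subset_span ⟨i, rfl⟩)
  have he0' : ∀ j, q (Fin.natAdd r j) = 0 := fun j => congrFun he0 j
  have hu0 : (fun i => q (Fin.castAdd k i)) = 0 := by
    apply hu
    simpa [he0'] using hq
  funext i
  induction i using Fin.addCases with
  | left i => exact congrFun hu0 i
  | right j => exact he0' j

/-- **A basis modulo `Λ` inside a finite tuple**: for `c : Fin N → F` there is a sub-tuple
`u = c ∘ σ` which is linearly independent over `Λ` with `Λ + ℚu = Λ + ℚc`. [folklore] -/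
theorem exists_linIndepOver_comp (Λ : Submodule ℚ F) {N : ℕ} (c : Fin N → F) :
    ∃ (r : ℕ) (σ : Fin r → Fin N), LinIndepOver Λ (c ∘ σ) ∧
      Λ ⊔ Submodule.span ℚ (range (c ∘ σ)) = Λ ⊔ Submodule.span ℚ (range c) := by
  classical
  -- a maximal linearly independent subset of the images in `F ⧸ Λ`
  obtain ⟨b, hbt, hbspan, hbind⟩ := exists_linearIndependent ℚ (range (Λ.mkQ ∘ c))
  have hbfin : b.Finite := (finite_range _).subset hbt
  haveI : Fintype b := hbfin.fintype
  -- choose preimage indices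
  have hpre : ∀ y : b, ∃ i : Fin N, Λ.mkQ (c i) = y := fun y => by
    obtain ⟨i, hi⟩ := hbt y.2
    exact ⟨i, hi⟩
  choose g hg using hpre
  let eqv := (Fintype.equivFin b).symm
  refine ⟨Fintype.card b, g ∘ eqv, ?_, ?_⟩
  · rw [linIndepOver_iff]
    have h1 : (Λ.mkQ ∘ (c ∘ (g ∘ eqv))) = (fun y : b => (y : F ⧸ Λ)) ∘ eqv := by
      funext i; simp [hg]
    rw [h1]
    exact hbind.comp _ eqv.injective
  · -- both sides have the same image in `F ⧸ Λ`
    apply le_antisymm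
    · refine sup_le le_sup_left (Submodule.span_le.2 ?_)
      rintro _ ⟨i, rfl⟩
      exact Submodule.mem_sup_right (Submodule.subset_span ⟨g (eqv i), rfl⟩)
    · refine sup_le le_sup_left (Submodule.span_le.2 ?_)
      rintro _ ⟨i, rfl⟩
      -- `mkQ (c i) ∈ span b`, so `c i ∈ Λ + span (c ∘ g ∘ eqv)`
      have hci : Λ.mkQ (c i) ∈ Submodule.span ℚ b := by
        rw [hbspan]; exact Submodule.subset_span ⟨i, rfl⟩
      have hb_sub : (b : Set (F ⧸ Λ)) ⊆
          (Submodule.span ℚ (range (c ∘ (g ∘ eqv)))).map Λ.mkQ := by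
        intro y hy
        refine ⟨c (g ⟨y, hy⟩), Submodule.subset_span ⟨eqv.symm ⟨y, hy⟩, by simp [eqv]⟩, ?_⟩
        rw [hg]
      have : Λ.mkQ (c i) ∈ (Submodule.span ℚ (range (c ∘ (g ∘ eqv)))).map Λ.mkQ :=
        (Submodule.span_le.2 hb_sub) hci
      obtain ⟨y, hy, hyc⟩ := this
      have hdiff : c i - y ∈ Λ := by
        rw [← Submodule.Quotient.eq, ← Submodule.mkQ_apply, ← Submodule.mkQ_apply, hyc]
      have : c i = (c i - y) + y := by abel
      rw [this]
      exact Submodule.add_mem _ (Submodule.mem_sup_left hdiff) (Submodule.mem_sup_right hy)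

/-- **Row space and `ldim`**: for `a` linearly independent over `Λ` and an integer matrix `M`,
the tuple of rows `(M a)ᵢ = ∑ⱼ Mᵢⱼ aⱼ` spans, modulo `Λ`, a space of dimension `rk M`.
[folklore] -/
theorem ldim_span_rows_eq_rank {Λ : Submodule ℚ F} {n k : ℕ} {a : Fin k → F}
    (ha : LinIndepOver Λ a) (M : Matrix (Fin n) (Fin k) ℤ) :
    ldim Λ (Submodule.span ℚ (range fun i => ∑ j, (M i j : F) * a j)) =
      (M.map (Int.cast : ℤ → ℚ)).rank := by
  classical
  rw [linIndepOver_iff] at ha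
  set Mq : Matrix (Fin n) (Fin k) ℚ := M.map (Int.cast : ℤ → ℚ) with hMq
  -- the injective map `ℚ^k → F ⧸ Λ`, `v ↦ ∑ vⱼ ā ⱼ`
  let φ : (Fin k → ℚ) →ₗ[ℚ] F ⧸ Λ := Fintype.linearCombination ℚ (Λ.mkQ ∘ a)
  have hφ : Function.Injective φ := ha.fintypeLinearCombination_injective
  -- the rows of `M` map to the rows `(M a)ᵢ` modulo `Λ`
  have hrow : ∀ i, Λ.mkQ (∑ j, (M i j : F) * a j) = φ (Mq.row i) := by
    intro i
    simp only [map_sum, φ, Fintype.linearCombination_apply, Function.comp_apply]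
    refine Finset.sum_congr rfl fun j _ => ?_
    rw [← map_smul]
    congr 1
    rw [hMq, Matrix.row, Matrix.map_apply, Rat.smul_def, Rat.cast_intCast]
  have hspan : (Submodule.span ℚ (range fun i => ∑ j, (M i j : F) * a j)).map Λ.mkQ =
      (Submodule.span ℚ (range Mq.row)).map φ := by
    rw [Submodule.map_span, Submodule.map_span, ← range_comp, ← range_comp]
    have : (⇑Λ.mkQ ∘ fun i => ∑ j, (M i j : F) * a j) = ⇑φ ∘ Mq.row := funext hrow
    rw [this]
  unfold ldim
  rw [hspan, Matrix.rank_eq_finrank_span_row]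
  exact (LinearEquiv.finrank_eq (Submodule.equivMapOfInjective φ hφ _)).symm

end LinAlg

/-! ### Exponentials of sums, kernel `τℤ`, roots of unity -/

section Roots

variable {F : Type*} [Field F] [CharZero F] [Literature.ModelTheory.ExponentialFields.ExponentialRing F]

omit [CharZero F] in
/-- `exp (∑ᵢ fᵢ) = ∏ᵢ exp fᵢ` over a finite index type. [folklore] -/
theorem exp_univ_sum {ι : Type*} [Fintype ι] (f : ι → F) : exp (∑ i, f i) = ∏ i, exp (f i) := by
  classical
  suffices h : ∀ s : Finset ι, exp (∑ i ∈ s, f i) = ∏ i ∈ s, exp (f i) from h _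
  intro s
  induction s using Finset.induction_on with
  | empty => simp [Literature.ModelTheory.ExponentialFields.ExponentialRing.exp_zero]
  | insert a s ha ih => rw [Finset.sum_insert ha, Finset.prod_insert ha, exp_add, ih]

variable {τ : F}

omit [CharZero F] in
/-- `exp τ = 1` when `ker exp = τℤ`. [folklore] -/
theorem exp_tau_eq_one (hker : expKernel F = AddSubgroup.zmultiples τ) : exp τ = 1 := by
  rw [← mem_expKernel_iff, hker]
  exact AddSubgroup.mem_zmultiples τ

omit [CharZero F] in
/-- If `exp x = 1` and `ker exp = τℤ` then `x = j τ` for an integer `j`. [folklore] -/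
theorem exists_eq_zsmul_of_exp_eq_one (hker : expKernel F = AddSubgroup.zmultiples τ) {x : F}
    (hx : exp x = 1) : ∃ j : ℤ, x = j • τ := by
  have : x ∈ expKernel F := (mem_expKernel_iff x).2 hx
  rw [hker, AddSubgroup.mem_zmultiples_iff] at this
  obtain ⟨j, hj⟩ := this
  exact ⟨j, hj.symm⟩

/-- If `(exp s)ᵐ = 1` (`m ≥ 1`) and `ker exp = τℤ` then `s ∈ ℚτ`. [folklore] -/
theorem mem_span_tau_of_pow_exp_eq_one (hker : expKernel F = AddSubgroup.zmultiples τ) {s : F}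
    {m : ℕ} (hm : 0 < m) (h : exp s ^ m = 1) : s ∈ Submodule.span ℚ ({τ} : Set F) := by
  rw [← exp_nsmul] at h
  obtain ⟨j, hj⟩ := exists_eq_zsmul_of_exp_eq_one hker h
  have hs : s = ((j : ℚ) / (m : ℚ)) • τ := by
    have hm0 : (m : F) ≠ 0 := Nat.cast_ne_zero.2 hm.ne'
    rw [nsmul_eq_mul] at hj
    rw [Rat.smul_def, Rat.cast_div, Rat.cast_intCast, Rat.cast_natCast, div_mul_eq_mul_div,
      eq_div_iff hm0, mul_comm, hj, zsmul_eq_mul]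
  rw [hs]
  exact Submodule.smul_mem _ _ (Submodule.subset_span rfl)

/-- `exp (τ/m)` is a primitive `m`-th root of unity (`ker exp = τℤ`, `τ ≠ 0`). [folklore] -/
theorem isPrimitiveRoot_exp_div (hker : expKernel F = AddSubgroup.zmultiples τ) (hτ : τ ≠ 0)
    {m : ℕ} (hm : 0 < m) : IsPrimitiveRoot (exp (τ / m)) m := by
  have hm0 : (m : F) ≠ 0 := Nat.cast_ne_zero.2 hm.ne'
  refine IsPrimitiveRoot.mk_of_lt _ hm ?_ ?_
  · rw [← exp_nsmul, nsmul_eq_mul, mul_div_cancel₀ _ hm0, exp_tau_eq_one hker]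
  · intro l hl0 hlm hl
    exfalso
    rw [← exp_nsmul] at hl
    obtain ⟨j, hj⟩ := exists_eq_zsmul_of_exp_eq_one hker hl
    rw [nsmul_eq_mul, zsmul_eq_mul, ← mul_div_assoc, div_eq_iff hm0] at hj
    -- `l τ = j m τ`, so `l = j m` with `0 < l < m`: impossible
    have h1 : (l : F) = (j : F) * m := by
      apply mul_right_cancel₀ hτ
      rw [hj]; ring
    have h2 : (l : ℤ) = j * m := by exact_mod_cast h1
    have hj0 : 0 < j := by
      by_contra hneg
      push Not at hneg
      have : (l : ℤ) ≤ 0 := by rw [h2]; exact mul_nonpos_of_nonpos_of_nonneg hneg (by positivity)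
      omega
    have : (m : ℤ) ≤ l := by rw [h2]; nlinarith
    omega

/-- **All roots of `exp v` are exponentials**: if `yᵐ = exp v` (`m ≥ 1`) then `y = exp (v/m + iτ/m)`
for some `i` — so the `m`-th roots of elements of `exp Λ` lie in `exp Λ` as soon as `τ ∈ Λ`.
[folklore] -/
theorem exists_exp_eq_of_pow_eq_exp (hker : expKernel F = AddSubgroup.zmultiples τ) (hτ : τ ≠ 0)
    {y v : F} {m : ℕ} (hm : 0 < m) (h : y ^ m = exp v) :
    ∃ i : ℕ, y = exp (v / m + i * (τ / m)) := by
  have hm0 : (m : F) ≠ 0 := Nat.cast_ne_zero.2 hm.ne'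
  haveI : NeZero m := ⟨hm.ne'⟩
  have hprim := isPrimitiveRoot_exp_div hker hτ hm
  set ζ := y / exp (v / m) with hζ
  have hζm : ζ ^ m = 1 := by
    rw [hζ, div_pow, h, ← exp_nsmul, nsmul_eq_mul, mul_div_cancel₀ _ hm0, div_self (exp_ne_zero v)]
  obtain ⟨i, -, hi⟩ := hprim.eq_pow_of_pow_eq_one hζm
  refine ⟨i, ?_⟩
  have hy : y = exp (v / m) * ζ := by
    rw [hζ, ← mul_div_assoc, mul_div_cancel_left₀ y (exp_ne_zero (v / (m : F)))]
  rw [hy, ← hi, ← exp_nsmul, ← exp_add, nsmul_eq_mul]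

/-- `allRoots (exp v) ⊆ exp (Λ)` for `v ∈ Λ` and `τ ∈ Λ`. [folklore] -/
theorem allRoots_exp_subset (hker : expKernel F = AddSubgroup.zmultiples τ) (hτ : τ ≠ 0)
    {Λ : Submodule ℚ F} (hτΛ : τ ∈ Λ) {v : F} (hv : v ∈ Λ) :
    Literature.FieldTheory.Kummer.allRoots (exp v) ⊆ exp '' (Λ : Set F) := by
  rintro y ⟨m, hm, hy⟩
  obtain ⟨i, rfl⟩ := exists_exp_eq_of_pow_eq_exp hker hτ hm hy
  refine ⟨v / m + i * (τ / m), ?_, rfl⟩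
  refine Λ.add_mem ?_ ?_
  · rw [div_natCast_eq_smul]; exact Λ.smul_mem _ hv
  · rw [← mul_div_assoc, div_natCast_eq_smul, ← nsmul_eq_mul]
    exact Λ.smul_mem _ (nsmul_mem hτΛ i)

/-- Roots of unity lie in `exp Λ` when `τ ∈ Λ`. [folklore] -/
theorem allRoots_one_subset (hker : expKernel F = AddSubgroup.zmultiples τ) (hτ : τ ≠ 0)
    {Λ : Submodule ℚ F} (hτΛ : τ ∈ Λ) : Literature.FieldTheory.Kummer.allRoots (1 : F) ⊆ exp '' (Λ : Set F) := by
  have := allRoots_exp_subset hker hτ hτΛ Λ.zero_mem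
  rwa [Literature.ModelTheory.ExponentialFields.ExponentialRing.exp_zero] at this

/-- **`(exp u, exp e)` is multiplicatively independent modulo roots of unity** when `(u, e)` is
linearly independent over `ℚτ` and `ker exp = τℤ` (Bays–Kirby 2018, proof of Prop. 3.22: "since
the extensions are kernel-preserving, `(a₂, b₂)` is linearly independent over `D₂`").
[cite: BaysKirby2018ANT, Prop. 3.22 (proof)] -/
theorem mulIndepModTorsion_exp (hker : expKernel F = AddSubgroup.zmultiples τ) {n : ℕ}
    {w : Fin n → F} (hw : LinIndepOver (Submodule.span ℚ ({τ} : Set F)) w) :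
    Literature.FieldTheory.Kummer.MulIndepModTorsion (fun i => exp (w i)) := by
  intro m hm
  rw [← exp_sum_intCast_mul] at hm
  obtain ⟨k, hk, hk1⟩ := hm
  have hmem := mem_span_tau_of_pow_exp_eq_one hker hk hk1
  have hmem' : ∑ i, (m i : ℚ) • w i ∈ Submodule.span ℚ ({τ} : Set F) := by
    convert hmem using 2 with i
    rw [Rat.smul_def, Rat.cast_intCast]
  by_contra hm0
  exact hw.sum_intCast_smul_notMem hm0 hmem'

end Roots

/-! ### Bridges: the algebraic matroid of `F/ℚ` versus algebra over a subfield -/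

section Bridges

open Cardinal Matroid

variable {F : Type*} [Field F] [CharZero F]

/-- **Algebraically independent witnesses from relative rank.** If `S = range v ⊆ F` has relative
rank `≥ r` over the subfield `L` in the algebraic matroid of `F/ℚ`, then some `r` of the `vᵢ` are
algebraically independent over `L` (a basis `I ⊆ S ∖ L` of `S` in the contraction by `L` is,
together with a transcendence basis `B` of `L/ℚ`, algebraically independent over `ℚ`, hence `I`
is algebraically independent over `ℚ(B)` and so over its algebraic extension `L`; the proof of
`Literature.NumberTheory.Transcendental.GammaField.relRank_le_toENat_trdeg_adjoin`). [folklore] -/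
theorem exists_algebraicIndependent_of_le_relRank (L : IntermediateField ℚ F) {ι : Type*}
    (v : ι → F) {r : ℕ} (h : (r : ℕ∞) ≤ (algMatroid F).relRank (L : Set F) (range v)) :
    ∃ s : Fin r → ι, AlgebraicIndependent L (v ∘ s) := by
  classical
  set M := algMatroid F
  set S := range v with hS
  obtain ⟨I, hI⟩ := (M ／ (L : Set F)).exists_isBasis (S \ (L : Set F))
    (by rw [contract_ground]; exact fun a ha => ⟨mem_univ a, ha.2⟩)
  rw [relRank_eq_relRank_diff, relRank_eq_eRk_contract, ← hI.encard_eq_eRk] at h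
  obtain ⟨B, hB⟩ := M.exists_isBasis (L : Set F) (subset_univ _)
  obtain ⟨hIB, hLI⟩ := hB.contract_indep_iff.1 hI.indep
  have hBL : B ⊆ (L : Set F) := hB.subset
  have hdisj : Disjoint I B := Disjoint.mono_right hBL hLI.symm
  have hinj : Function.Injective (Sum.elim ((↑) : I → F) ((↑) : B → F)) := by
    rintro (a | a) (b | b) hab
    · exact congrArg Sum.inl (Subtype.ext hab)
    · exact (Set.disjoint_left.1 hdisj a.2 ((show (a : F) = b from hab) ▸ b.2)).elim
    · exact (Set.disjoint_left.1 hdisj b.2 ((show (a : F) = b from hab) ▸ a.2)).elim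
    · exact congrArg Sum.inr (Subtype.ext hab)
  have hsum : AlgebraicIndependent ℚ (Sum.elim ((↑) : I → F) ((↑) : B → F)) := by
    have hind : AlgebraicIndepOn ℚ id (I ∪ B) := AlgebraicIndependent.matroid_indep_iff.1 hIB
    refine (algebraicIndependent_subtype_range hinj).1 ?_
    rw [Sum.elim_range, Subtype.range_coe, Subtype.range_coe]
    exact hind
  set R := Algebra.adjoin ℚ (range ((↑) : B → F)) with hR
  have hI' : AlgebraicIndependent R ((↑) : I → F) := (AlgebraicIndependent.sumElim_iff.1 hsum).2
  have hRL : R ≤ L.toSubalgebra := by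
    rw [hR, Subtype.range_coe]; exact Algebra.adjoin_le hBL
  letI : Algebra R L := (Subalgebra.inclusion hRL).toRingHom.toAlgebra
  haveI : IsScalarTower R L F := IsScalarTower.of_algebraMap_eq fun _ => rfl
  haveI : Algebra.IsAlgebraic R L := by
    refine ⟨fun y => ?_⟩
    have hinj' : Function.Injective (algebraMap L F) := (algebraMap L F).injective
    rw [← isAlgebraic_algebraMap_iff hinj']
    have hy : (y : F) ∈ acl B := by
      have : (L : Set F) ⊆ M.closure B := hB.subset_closure
      exact this y.2
    rw [mem_acl_iff] at hy
    rw [hR, Subtype.range_coe]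
    exact hy
  have hIL : AlgebraicIndependent L ((↑) : I → F) := hI'.extendScalars L
  -- pick `r` elements of `I` and preimage indices
  obtain ⟨I₀, hI₀I, hI₀card⟩ := Set.exists_subset_encard_eq h
  have hI₀fin : I₀.Finite := finite_of_encard_eq_coe hI₀card
  haveI : Finite I₀ := hI₀fin.to_subtype
  have hcard : Nat.card I₀ = r := by
    have := hI₀fin.encard_eq_coe_toFinset_card
    rw [hI₀card] at this
    rw [Nat.card_coe_set_eq, Set.ncard_eq_toFinset_card _ hI₀fin]
    exact_mod_cast this.symm
  let eqv : I₀ ≃ Fin r := (Finite.equivFin I₀).trans (finCongr hcard)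
  have hpre : ∀ y : I₀, ∃ i : ι, v i = y := fun y => (hI.subset (hI₀I y.2)).1
  choose g hg using hpre
  refine ⟨g ∘ eqv.symm, ?_⟩
  have h1 : v ∘ (g ∘ eqv.symm) = ((↑) : I → F) ∘ (fun y : I₀ => (⟨y, hI₀I y.2⟩ : I)) ∘ eqv.symm := by
    funext i; simp [hg]
  rw [h1]
  refine hIL.comp _ ?_
  intro a b hab
  have hab' : ((eqv.symm a : I₀) : F) = (eqv.symm b : I₀) := by
    simpa using congrArg (fun z : I => (z : F)) hab
  exact eqv.symm.injective (Subtype.ext hab')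

/-- **`trdeg` over a subfield versus relative rank**, `Algebra.adjoin` form: for a subfield `L`
(an intermediate field of `F/ℚ`) and `S ⊆ F`, `toENat (trdeg_L L[S]) = relRank (L) S` in the
algebraic matroid of `F/ℚ` (`Literature.NumberTheory.Transcendental.GammaField.toENat_trdeg_adjoin_eq_relRank`). [folklore] -/
theorem toENat_trdeg_algebra_adjoin_eq_relRank (L : IntermediateField ℚ F) (S : Set F) :
    toENat (Algebra.trdeg L (Algebra.adjoin L S)) = (algMatroid F).relRank (L : Set F) S := by
  rw [← trdeg_intermediateField_adjoin_eq, toENat_trdeg_adjoin_eq_relRank]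

end Bridges

/-! ### The locus ideal of a point over a coefficient field -/

section LocIdeal

variable {F : Type u} [Field F] (kk : Type u) [Field kk] [Algebra kk F] {n : ℕ}
  (p : Fin n ⊕ Fin n → F)

/-- The **locus ideal** `I(p/kk) ⊆ kk[X, Y]` of a point `p ∈ F^{n ⊕ n}` over a coefficient field
`kk → F`: Mathlib's two-field vanishing ideal `MvPolynomial.vanishingIdeal kk {p}` (prime by
Mathlib's instance), named here because it is the running object of the whole file.
[cite: BaysKirby2018ANT, §3.3 (`loc(b/A)`)] -/
abbrev locIdeal : Ideal (MvPolynomial (Fin n ⊕ Fin n) kk) :=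
  MvPolynomial.vanishingIdeal kk ({p} : Set (Fin n ⊕ Fin n → F))

/-- `p` is a generic point of its locus. [folklore] -/
theorem isGenericPt_locIdeal : IsGenericPt (locIdeal kk p) p :=
  (isGenericPt_iff_vanishingIdeal_singleton_eq _ _).2 rfl

end LocIdeal

/-! ### Generic trdeg lemmas -/

section GenericTrdeg

variable {F : Type u} [Field F] {kk : Type u} [Field kk] [Algebra kk F] {n : ℕ}

/-- For a generic point `ζ ∈ F^{n ⊕ n}` of `Z(P)` over `kk`, `trdeg kk[Z(P)] = trdeg kk[ζ]`
(`kk[X] ⧸ P ≃ kk[ζ]`). [folklore] -/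
theorem trdeg_coordRing_eq_of_isGenericPt {P : Ideal (MvPolynomial (Fin n ⊕ Fin n) kk)}
    {ζ : Fin n ⊕ Fin n → F} (hζ : IsGenericPt P ζ) :
    Algebra.trdeg kk (zeroLocusCoordRing P) = Algebra.trdeg kk (Algebra.adjoin kk (range ζ)) := by
  let g₀ : MvPolynomial (Fin n ⊕ Fin n) kk →ₐ[kk] Algebra.adjoin kk (range ζ) :=
    (aeval ζ).codRestrict (Algebra.adjoin kk (range ζ)) fun f => by
      rw [Algebra.adjoin_range_eq_range_aeval]; exact ⟨f, rfl⟩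
  have hg₀ : Function.Surjective g₀ := by
    rintro ⟨y, hy⟩
    rw [Algebra.adjoin_range_eq_range_aeval] at hy
    obtain ⟨f, rfl⟩ := hy
    exact ⟨f, rfl⟩
  have hker : RingHom.ker g₀ = P := by
    rw [← (isGenericPt_iff_ker_eq P ζ).1 hζ]
    ext f
    rw [RingHom.mem_ker, RingHom.mem_ker, Subtype.ext_iff]
    rfl
  have e : zeroLocusCoordRing P ≃ₐ[kk] Algebra.adjoin kk (range ζ) :=
    (Ideal.quotientEquivAlgOfEq kk hker.symm).trans (Ideal.quotientKerAlgEquivOfSurjective hg₀)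
  have h1 := e.lift_trdeg_eq
  simpa only [Cardinal.lift_id] using h1

end GenericTrdeg

/-! ### The locus of `(a, exp a)` over the Γ-field `⟨K c⟩` -/

section LocusData

variable {F : Type u} [Field F] [CharZero F] [Literature.ModelTheory.ExponentialFields.ExponentialRing F]
variable (K : Submodule ℚ F) {N : ℕ} (c : Fin N → F)

/-- The Γ-field `⟨K c⟩ = K₀(allGens c)` of `K + ℚc` as an intermediate field over
`K₀ = ℚ(K, exp K)` (`ZilberSaturation.lean`); its carrier is `fieldOf (K + ℚc)`
(`GammaField.restrictScalars_adjoinField_allGens`). [cite: BaysKirby2018ANT, Def. 3.15] -/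
abbrev bfld : IntermediateField (fieldOf K) F := IntermediateField.adjoin (fieldOf K) (allGens c)

/-- The carrier of `⟨K c⟩` is `fieldOf (K + ℚc)`. [folklore] -/
theorem coe_bfld_restrictScalars :
    (((bfld K c).restrictScalars ℚ : IntermediateField ℚ F) : Set F) =
      (fieldOf (K ⊔ Submodule.span ℚ (range c)) : Set F) := by
  rw [restrictScalars_adjoinField_allGens]

/-- The carrier of `⟨K c⟩` lies in `acl (gens (K + ℚc))`. [folklore] -/
theorem coe_bfld_subset_acl :
    ((bfld K c : IntermediateField (fieldOf K) F) : Set F) ⊆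
      acl (gens (K ⊔ Submodule.span ℚ (range c))) := by
  intro x hx
  have hx' : x ∈ fieldOf (K ⊔ Submodule.span ℚ (range c)) := (mem_adjoinField_allGens_iff K c).1 hx
  exact fieldOf_subset_acl _ hx'

/-- The closure of the carrier of `⟨K c⟩` in the algebraic matroid is that of `gens (K + ℚc)`.
[folklore] -/
theorem closure_coe_bfld :
    (algMatroid F).closure (((bfld K c).restrictScalars ℚ : IntermediateField ℚ F) : Set F) =
      (algMatroid F).closure (gens (K ⊔ Submodule.span ℚ (range c))) := by
  rw [coe_bfld_restrictScalars]
  exact acl_fieldOf _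

/-- Elements outside `acl (gens (K + ℚc))` are transcendental over `⟨K c⟩`. [folklore] -/
theorem transcendental_bfld_of_not_mem_acl {t : F}
    (ht : t ∉ acl (gens (K ⊔ Submodule.span ℚ (range c)))) : Transcendental (bfld K c) t :=
  ZilberHomogeneity.transcendental_of_not_mem_acl (bfld K c).toSubalgebra (coe_bfld_subset_acl K c) ht

variable {k : ℕ} (a : Fin k → F)

/-- The **locus ideal** `I((a, exp a)/⟨K c⟩) ⊆ ⟨K c⟩[X, Y]` of the point `(a, exp a) ∈ Gᵏ(F)`.
[cite: BaysKirby2018ANT, §3.3 (`loc(b/A)`)] -/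
abbrev locusIdeal : Ideal (MvPolynomial (Fin k ⊕ Fin k) (bfld K c)) := locIdeal (bfld K c) (gammaPt a)

/-- `(a, exp a)` is a generic point of its locus. [folklore] -/
theorem isGenericPt_locusIdeal : IsGenericPt (locusIdeal K c a) (gammaPt a) :=
  isGenericPt_locIdeal _ _

/-- `Yᵢ ∉ I((a, exp a))`. [folklore] -/
theorem X_inr_notMem_locusIdeal (i : Fin k) :
    (X (Sum.inr i) : MvPolynomial (Fin k ⊕ Fin k) (bfld K c)) ∉ locusIdeal K c a := by
  rw [LocusComponents.X_inr_notMem_iff _ (isGenericPt_locusIdeal K c a), gammaPt_inr]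
  exact exp_ne_zero _

omit [CharZero F] in
/-- `[M] (a, exp a) = (M a, exp (M a))`. [folklore] -/
theorem matrixAct_gammaPt (M : Matrix (Fin k) (Fin k) ℤ) :
    matrixAct M (gammaPt a) = gammaPt fun i => ∑ j, (M i j : F) * a j := by
  funext x
  cases x with
  | inl i => simp [matrixAct_inl]
  | inr i => simp [matrixAct_inr, exp_sum_intCast_mul]

omit [CharZero F] in
/-- `range (a, exp a) = range a ∪ exp (range a)`. [folklore] -/
theorem range_gammaPt (b : Fin k → F) : range (gammaPt b) = range b ∪ exp '' range b := by
  rw [gammaPt, Set.Sum.elim_range, ← range_comp]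
  rfl

/-- **Freeness data** (additive): a non-trivial `ℤ`-combination of the `aⱼ` lying outside
`acl (gens (K + ℚc))` is transcendental over `⟨K c⟩`. [cite: BaysKirby2018ANT, Cor. 7.4] -/
theorem transcendental_sum (m : Fin k → ℤ)
    (h : ∑ j, (m j : ℚ) • a j ∉ acl (gens (K ⊔ Submodule.span ℚ (range c)))) :
    Transcendental (bfld K c) (∑ j, (m j : F) * gammaPt a (Sum.inl j)) := by
  have : ∑ j, (m j : F) * gammaPt a (Sum.inl j) = ∑ j, (m j : ℚ) • a j := by
    refine Finset.sum_congr rfl fun j _ => ?_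
    rw [gammaPt_inl, Rat.smul_def, Rat.cast_intCast]
  rw [this]
  exact transcendental_bfld_of_not_mem_acl K c h

/-- **Freeness data** (multiplicative): if `exp` of a non-trivial `ℤ`-combination of the `aⱼ`
lies outside `acl (gens (K + ℚc))`, the corresponding Laurent monomial in `exp a` is
transcendental over `⟨K c⟩`. [cite: BaysKirby2018ANT, Cor. 7.4] -/
theorem transcendental_prod (m : Fin k → ℤ)
    (h : exp (∑ j, (m j : ℚ) • a j) ∉ acl (gens (K ⊔ Submodule.span ℚ (range c)))) :
    Transcendental (bfld K c) (∏ j, gammaPt a (Sum.inr j) ^ m j) := by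
  have : ∏ j, gammaPt a (Sum.inr j) ^ m j = exp (∑ j, (m j : ℚ) • a j) := by
    simp only [gammaPt_inr]
    rw [← exp_sum_intCast_mul]
    congr 1
    refine Finset.sum_congr rfl fun j _ => ?_
    rw [Rat.smul_def, Rat.cast_intCast]
  rw [this]
  exact transcendental_bfld_of_not_mem_acl K c h

/-- **Rotundity data from strongness** (Bays–Kirby 2018, Prop. 7.3: "`ldim(M·b/Γ(A)) = rk M`" and
"the extension is strong iff for all `M` we have `td(M·b/A) ≥ d rk M`"): if `K + ℚc ◁ F` and `a` is
linearly independent over `K + ℚc`, then for every `M` some `rk M` coordinates of `[M](a, exp a)`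
are algebraically independent over `⟨K c⟩`. [cite: BaysKirby2018ANT, Prop. 7.3 (proof)] -/
theorem exists_algebraicIndependent_matrixAct (hX : IsStrong (K ⊔ Submodule.span ℚ (range c)))
    (ha : LinIndepOver (K ⊔ Submodule.span ℚ (range c)) a) (M : Matrix (Fin k) (Fin k) ℤ) :
    ∃ s : Fin (M.map (Int.cast : ℤ → ℚ)).rank → Fin k ⊕ Fin k,
      AlgebraicIndependent (bfld K c) fun i => matrixAct M (gammaPt a) (s i) := by
  set X := K ⊔ Submodule.span ℚ (range c) with hXdef
  set w : Fin k → F := fun i => ∑ j, (M i j : F) * a j with hw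
  set V := Submodule.span ℚ (range w) with hV
  -- `δ(V/X) ≥ 0`, `ldim(V/X) = rk M`, so `td(V/X) ≥ rk M`
  have hfg : IsFG X V := isFG_span_of_finite X (finite_range w)
  have hδ : 0 ≤ predim X V := (isStrong_iff.1 hX) V hfg
  have hldim : ldim X V = (M.map (Int.cast : ℤ → ℚ)).rank := ldim_span_rows_eq_rank ha M
  have htd : ((M.map (Int.cast : ℤ → ℚ)).rank : ℕ∞) ≤ td X V := by
    rw [predim_def, hldim] at hδ
    have h1 : (M.map (Int.cast : ℤ → ℚ)).rank ≤ (td X V).toNat := by omega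
    have h2 : ((td X V).toNat : ℕ∞) = td X V := ENat.coe_toNat (td_ne_top hfg)
    rw [← h2]
    exact_mod_cast h1
  -- hence the relative rank of the coordinates of `[M](a, exp a)` over `⟨K c⟩` is `≥ rk M`
  have hrel : ((M.map (Int.cast : ℤ → ℚ)).rank : ℕ∞) ≤ (algMatroid F).relRank
      (((bfld K c).restrictScalars ℚ : IntermediateField ℚ F) : Set F)
      (range (matrixAct M (gammaPt a))) := by
    rw [(algMatroid F).relRank_congr_closure_left _ (closure_coe_bfld K c), matrixAct_gammaPt,
      range_gammaPt]
    exact htd.trans (td_span_le_relRank X (range w))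
  obtain ⟨s, hs⟩ := exists_algebraicIndependent_of_le_relRank ((bfld K c).restrictScalars ℚ)
    (matrixAct M (gammaPt a)) hrel
  exact ⟨s, hs⟩

/-- `toENat (trdeg_{⟨K c⟩} ⟨K c⟩[S])` is the relative rank of `S` over `⟨K c⟩`
(`toENat_trdeg_algebra_adjoin_eq_relRank` read on the intermediate field `⟨K c⟩` over `K₀`,
whose underlying subfield is that of `(⟨K c⟩).restrictScalars ℚ`). [folklore] -/
theorem toENat_trdeg_adjoin_bfld (S : Set F) :
    Cardinal.toENat (Algebra.trdeg (bfld K c) (Algebra.adjoin (bfld K c) S)) =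
      (algMatroid F).relRank (((bfld K c).restrictScalars ℚ : IntermediateField ℚ F) : Set F) S :=
  toENat_trdeg_algebra_adjoin_eq_relRank ((bfld K c).restrictScalars ℚ) S

/-- **Relative rank of the coordinates of `(a, exp a)`** over `⟨K c⟩` equals `td(a/K + ℚc)`.
[folklore] -/
theorem relRank_range_gammaPt :
    (algMatroid F).relRank (((bfld K c).restrictScalars ℚ : IntermediateField ℚ F) : Set F)
      (range (gammaPt a)) = td (K ⊔ Submodule.span ℚ (range c)) (Submodule.span ℚ (range a)) := by
  set X := K ⊔ Submodule.span ℚ (range c) with hXdef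
  rw [(algMatroid F).relRank_congr_closure_left _ (closure_coe_bfld K c), range_gammaPt]
  apply le_antisymm
  · -- the coordinates are generators of `X + ℚa`
    calc (algMatroid F).relRank (gens X) (range a ∪ exp '' range a)
        ≤ (algMatroid F).relRank (gens X) (gens (X ⊔ Submodule.span ℚ (range a))) := by
          refine (algMatroid F).relRank_mono_right _ ?_
          rintro b (⟨j, rfl⟩ | ⟨_, ⟨j, rfl⟩, rfl⟩)
          · exact mem_gens_of_mem (Submodule.mem_sup_right (Submodule.subset_span ⟨j, rfl⟩))
          · exact exp_mem_gens (Submodule.mem_sup_right (Submodule.subset_span ⟨j, rfl⟩))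
      _ = td X (Submodule.span ℚ (range a)) := by rw [← td_def, td_sup_left]
  · exact td_span_le_relRank X (range a)

/-- **`trdeg` of the coordinate ring of the locus**: `trdeg_{⟨K c⟩} ⟨K c⟩[loc] = td(a/K + ℚc)`
(through `toENat`). [folklore] -/
theorem toENat_trdeg_coordRing_locusIdeal :
    Cardinal.toENat (Algebra.trdeg (bfld K c) (zeroLocusCoordRing (locusIdeal K c a))) =
      td (K ⊔ Submodule.span ℚ (range c)) (Submodule.span ℚ (range a)) := by
  rw [trdeg_coordRing_eq_of_isGenericPt (isGenericPt_locusIdeal K c a), toENat_trdeg_adjoin_bfld,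
    relRank_range_gammaPt]

/-- The transcendence degree of the coordinate ring of the locus, as a cardinal, when
`td(a/K + ℚc) = k`. [folklore] -/
theorem trdeg_coordRing_locusIdeal_eq {d : ℕ}
    (htd : td (K ⊔ Submodule.span ℚ (range c)) (Submodule.span ℚ (range a)) = d) :
    Algebra.trdeg (bfld K c) (zeroLocusCoordRing (locusIdeal K c a)) = d := by
  have h := toENat_trdeg_coordRing_locusIdeal K c a
  rw [htd] at h
  exact (Cardinal.toENat_eq_natCast).1 h

/-- The Krull dimension of the coordinate ring of the locus is `td(a/K + ℚc)`. [folklore] -/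
theorem ringKrullDim_coordRing_locusIdeal_eq {d : ℕ}
    (htd : td (K ⊔ Submodule.span ℚ (range c)) (Submodule.span ℚ (range a)) = d) :
    ringKrullDim (zeroLocusCoordRing (locusIdeal K c a)) = d := by
  rw [Literature.RingTheory.KrullDimension.ringKrullDim_eq_trdeg (bfld K c), trdeg_coordRing_locusIdeal_eq K c a htd,
    Cardinal.toNat_natCast]

end LocusData

/-! ### The strong-exponential-closedness step: a generic partner on the `c'` side -/

section SEACStep

variable {F : Type u} [Field F] [CharZero F] [Literature.ModelTheory.ExponentialFields.ExponentialRing F]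
variable (K : Submodule ℚ F) {N : ℕ} {c c' : Fin N → F} (hiso : IsGammaIso K c c')
  {k : ℕ} (a : Fin k → F)

/-- The locus ideal transported to the `c'` side along the Γ-isomorphism `θ : ⟨K c⟩ ≅ ⟨K c'⟩`:
`P' = θ(I((a, exp a)/⟨K c⟩)) ⊆ ⟨K c'⟩[X, Y]`. [cite: BaysKirby2018ANT, Def. 3.19 (`loc(b'/A) = loc(b/A)`)] -/
abbrev locusIdeal' : Ideal (MvPolynomial (Fin k ⊕ Fin k) (bfld K c')) :=
  LocusComponents.idealMapCoeff hiso.fieldEquiv (locusIdeal K c a)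

/-- `P'` is prime (an instance of Mathlib's `Ideal.map_isPrime_of_equiv`; recorded for `haveI`).
[folklore] -/
theorem locusIdeal'_isPrime : (locusIdeal' K hiso a).IsPrime :=
  LocusComponents.idealMapCoeff_isPrime _ _

omit [Literature.ModelTheory.ExponentialFields.ExponentialRing F] in
/-- From Kirby's integer linear-independence condition over a spanning finite set to
`LinIndepOver`. [folklore] -/
theorem linIndepOver_of_forall_intCast {Λ : Submodule ℚ F} (T : Finset F)
    (hT : Submodule.span ℚ (↑T : Set F) = Λ) {x : Fin k → F}
    (h : ∀ m : Fin k → ℤ, (∑ i, (m i : F) * x i) ∈ Submodule.span ℚ (↑T : Set F) → m = 0) :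
    LinIndepOver Λ x := by
  classical
  have hT' : (↑T : Set F) = range ((↑) : T → F) := (Subtype.range_coe).symm
  rw [hT'] at h hT
  rw [forall_intCast_mul_mem_span_iff] at h
  intro q hq
  rw [← hT, Submodule.mem_span_range_iff_exists_fun] at hq
  obtain ⟨q', hq'⟩ := hq
  refine h q (fun j => -q' j) ?_
  simp only [neg_smul, Finset.sum_neg_distrib, hq']
  exact add_neg_cancel _

variable [IsAlgClosed F]

set_option synthInstance.maxHeartbeats 200000 in
set_option maxHeartbeats 400000 in
/-- **The generic partner.** Let `K + ℚc ◁ F`, `K + ℚc' ◁ F`, `θ : ⟨K c⟩ ≅ ⟨K c'⟩` a Γ-isomorphism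
over `K`, `a` a `k`-tuple linearly independent over `K + ℚc` with `td(a/K + ℚc) = k`
(Γ-algebraic) whose locus over `⟨K c⟩` is free (every non-trivial `ℤ`-combination of the `aⱼ`,
and its exponential, lie outside `acl`), and let `K + ℚc'` be spanned by a finite set `T`. If `F`
is algebraically closed and strongly exponentially-algebraically closed, there is `x` with
`(x, exp x)` a **generic point of `θ(loc((a, exp a)/⟨K c⟩))` over `⟨K c'⟩`**, `x` linearly
independent over `K + ℚc'`, and `td(x/K + ℚc') = k`. This is the core of Bays–Kirby 2018,
Lemma 8.3 (⟹): axiom 4 applied to an absolutely irreducible component `Z(Q)` of `V = loc(b/A)`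
(free and rotund of dimension `k`, `LocusComponents.lean`), linear independence over
`Γ(F_base) ∪ a` (Kirby's scheme, `IsStronglyExpAlgClosed.isLinIndepExpAlgClosed`), and "since
`A ◁ F`, `td(c/A) = dim V`, thus `c` is generic in `V` over `A`".
[cite: BaysKirby2018ANT, Lemma 8.3 (proof)] -/
theorem exists_generic_partner (hSEAC : IsStronglyExpAlgClosed F)
    (hX : IsStrong (K ⊔ Submodule.span ℚ (range c)))
    (hX' : IsStrong (K ⊔ Submodule.span ℚ (range c')))
    (ha : LinIndepOver (K ⊔ Submodule.span ℚ (range c)) a)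
    (htd : td (K ⊔ Submodule.span ℚ (range c)) (Submodule.span ℚ (range a)) = k)
    (hfree : ∀ m : Fin k → ℤ, m ≠ 0 →
      ∑ j, (m j : ℚ) • a j ∉ acl (gens (K ⊔ Submodule.span ℚ (range c))) ∧
      exp (∑ j, (m j : ℚ) • a j) ∉ acl (gens (K ⊔ Submodule.span ℚ (range c))))
    (T : Finset F) (hT : Submodule.span ℚ (↑T : Set F) = K ⊔ Submodule.span ℚ (range c')) :
    ∃ x : Fin k → F, IsGenericPt (locusIdeal' K hiso a) (gammaPt x) ∧
      LinIndepOver (K ⊔ Submodule.span ℚ (range c')) x ∧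
      td (K ⊔ Submodule.span ℚ (range c')) (Submodule.span ℚ (range x)) = k := by
  classical
  set X := K ⊔ Submodule.span ℚ (range c) with hXdef
  set X' := K ⊔ Submodule.span ℚ (range c') with hX'def
  set θ := hiso.fieldEquiv with hθ
  set P := locusIdeal K c a with hP
  set P' : Ideal (MvPolynomial (Fin k ⊕ Fin k) (bfld K c')) := locusIdeal' K hiso a with hP'
  haveI : P'.IsPrime := locusIdeal'_isPrime K hiso a
  -- a component `Z(Q)` of `Z(P')_F`
  obtain ⟨Q, hQ⟩ := LocusComponents.exists_mem_minimalPrimes_map (k := bfld K c') (F := F) (P := P')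
  haveI : Q.IsPrime := hQ.1.1
  set W : Set (Fin k ⊕ Fin k → F) := zeroLocus F Q with hW
  -- data on the generic point of `P`, transported to `P'`
  have hY : ∀ i, (MvPolynomial.X (Sum.inr i) : MvPolynomial (Fin k ⊕ Fin k) (bfld K c')) ∉ P' :=
    fun i => (LocusComponents.X_inr_notMem_mapCoeff_iff θ P i).2 (X_inr_notMem_locusIdeal K c a i)
  have hrot : ∀ M : Matrix (Fin k) (Fin k) ℤ,
      ∃ s : Fin (M.map (Int.cast : ℤ → ℚ)).rank → Fin k ⊕ Fin k,
        AlgebraicIndependent (bfld K c') fun i => matrixAct M (genericPt P') (s i) := by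
    intro M
    obtain ⟨s, hs⟩ := exists_algebraicIndependent_matrixAct K c a hX ha M
    refine ⟨s, LocusComponents.algebraicIndependent_matrixAct_genericPt_mapCoeff θ P M s ?_⟩
    exact LocusComponents.algebraicIndependent_matrixAct_genericPt P (isGenericPt_locusIdeal K c a)
      M s hs
  have hadd : ∀ m : Fin k → ℤ, m ≠ 0 → Transcendental (bfld K c')
      (∑ i, (m i : zeroLocusFunctionField P') * genericPt P' (Sum.inl i)) := by
    intro m hm
    refine LocusComponents.transcendental_sum_genericPt_mapCoeff θ P m ?_
    exact LocusComponents.transcendental_sum_genericPt P (isGenericPt_locusIdeal K c a) m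
      (transcendental_sum K c a m (hfree m hm).1)
  have hmul : ∀ m : Fin k → ℤ, m ≠ 0 → Transcendental (bfld K c')
      (∏ i, genericPt P' (Sum.inr i) ^ m i) := by
    intro m hm
    refine LocusComponents.transcendental_prod_genericPt_mapCoeff θ P m ?_
    exact LocusComponents.transcendental_prod_genericPt P (isGenericPt_locusIdeal K c a) m
      (transcendental_prod K c a m (hfree m hm).2)
  -- the hypotheses of strong exponential-algebraic closedness for `W = Z(Q)`
  have hirr : IsIrreducibleClosed F W := LocusComponents.isIrreducibleClosed_component
  have hne : (W ∩ torusLocus F k).Nonempty :=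
    LocusComponents.component_inter_torusLocus_nonempty hQ hY
  have hrotW : IsRotund F k (W ∩ torusLocus F k) := LocusComponents.isRotund_component hQ hY hrot
  have haddW : IsAddFree F k (W ∩ torusLocus F k) := LocusComponents.isAddFree_component hQ hY hadd
  have hmulW : IsMulFree F k (W ∩ torusLocus F k) := LocusComponents.isMulFree_component hQ hY hmul
  have hdimP : ringKrullDim (zeroLocusCoordRing P) = k := ringKrullDim_coordRing_locusIdeal_eq K c a htd
  have hdimP' : ringKrullDim (zeroLocusCoordRing P') = k := by
    rw [hP', locusIdeal', LocusComponents.ringKrullDim_quotient_mapCoeff]; exact hdimP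
  have hdimW : zariskiDim F W = k := by
    rw [hW, LocusComponents.zariskiDim_component hQ]; exact hdimP'
  obtain ⟨F₀, hF₀⟩ := IsZariskiClosed.exists_isDefinedOver hirr.1
  -- Kirby's scheme: a point `(x, exp x) ∈ W` with `x` integrally independent over `span T`
  obtain ⟨z, ⟨hzW, hzexp⟩, hzlin⟩ :=
    hSEAC.isLinIndepExpAlgClosed k W hirr hne hrotW haddW hmulW hdimW T
  set x : Fin k → F := z ∘ Sum.inl with hx
  have hz : z = gammaPt x := (mem_expGraph_iff_eq_gammaPt z).1 hzexp
  have hlin : LinIndepOver X' x := linIndepOver_of_forall_intCast T hT hzlin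
  -- `td(x/X') ≥ k` by strongness of `X'`
  have hfg : IsFG X' (Submodule.span ℚ (range x)) := isFG_span_of_finite X' (finite_range x)
  have hδ : 0 ≤ predim X' (Submodule.span ℚ (range x)) := (isStrong_iff.1 hX') _ hfg
  have hldim : ldim X' (Submodule.span ℚ (range x)) = k := ldim_span_eq_of_linIndepOver hlin
  have htd_ge : (k : ℕ∞) ≤ td X' (Submodule.span ℚ (range x)) := by
    rw [predim_def, hldim] at hδ
    have h1 : k ≤ (td X' (Submodule.span ℚ (range x))).toNat := by omega
    rw [← ENat.coe_toNat (td_ne_top hfg)]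
    exact_mod_cast h1
  -- relative rank of the coordinates of `(x, exp x)` over `⟨K c'⟩`
  have hrel : (algMatroid F).relRank (((bfld K c').restrictScalars ℚ : IntermediateField ℚ F) : Set F)
      (range (gammaPt x)) = td X' (Submodule.span ℚ (range x)) := relRank_range_gammaPt K c' x
  -- genericity
  have hzP' : gammaPt x ∈ zeroLocus F P' := by
    rw [← hz]; exact LocusComponents.zeroLocus_subset_zeroLocus hQ hzW
  have htrP' : Algebra.trdeg (bfld K c') (zeroLocusCoordRing P') = k := by
    have h1 := Literature.RingTheory.KrullDimension.ringKrullDim_eq_trdeg (bfld K c') (zeroLocusCoordRing P')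
    rw [hdimP'] at h1
    have h2 : Cardinal.toNat (Algebra.trdeg (bfld K c') (zeroLocusCoordRing P')) = k := by
      exact_mod_cast h1.symm
    rw [Literature.RingTheory.KrullDimension.trdeg_eq_toNat (bfld K c') (zeroLocusCoordRing P'), h2]
  have hgen : IsGenericPt P' (gammaPt x) := by
    refine LocusComponents.isGenericPt_of_trdeg_le P' hzP' ?_
    rw [htrP']
    refine Cardinal.natCast_le_toENat.1 ?_
    rw [toENat_trdeg_adjoin_bfld, hrel]
    exact htd_ge
  -- `td(x/X') = k`
  have htd_eq : td X' (Submodule.span ℚ (range x)) = k := by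
    refine le_antisymm ?_ htd_ge
    rw [← hrel, ← toENat_trdeg_adjoin_bfld, ← trdeg_coordRing_eq_of_isGenericPt hgen, htrP',
      Cardinal.toENat_nat]
  exact ⟨x, hgen, hlin, htd_eq⟩

end SEACStep

/-! ### Twisting the algebra structure of a field along a ring homomorphism -/

section Twisted

/-- `F` regarded as an `L`-algebra through a given ring homomorphism `f : L → F` (a type synonym,
used to instantiate the named Kummer fact, which quantifies over `L`-algebras, at the algebra
structure `f` rather than at an inclusion of subfields). [folklore] -/
@[nolint unusedArguments]
def Twisted {L F : Type*} [Field L] [Field F] (_f : L →+* F) : Type _ := F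

variable {L F : Type*} [Field L] [Field F] (f : L →+* F)

/-- The field structure of `F` on the synonym. [folklore] -/
instance Twisted.instField : Field (Twisted f) := inferInstanceAs (Field F)

/-- The `L`-algebra structure `f` on the synonym. [folklore] -/
instance Twisted.instAlgebra : Algebra L (Twisted f) := RingHom.toAlgebra (f : L →+* F)

/-- The identification `F = Twisted f` on elements. [folklore] -/
def Twisted.of : F ≃ Twisted f := Equiv.refl F

/-- `algebraMap L (Twisted f) = f`. [folklore] -/
theorem Twisted.algebraMap_eq : (algebraMap L (Twisted f) : L →+* Twisted f) = f := rfl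

/-- Kernels over the twisted algebra are kernels of `eval₂Hom f`. [folklore] -/
theorem Twisted.ker_aeval_eq {I : Type*} (v : I → F) :
    RingHom.ker (aeval (fun i => Twisted.of f (v i)) : MvPolynomial I L →ₐ[L] Twisted f) =
      RingHom.ker (eval₂Hom f v : MvPolynomial I L →+* F) := by
  ext P
  rw [RingHom.mem_ker, RingHom.mem_ker]
  exact Iff.rfl

end Twisted

/-! ### The embeddings attached to the locus and to its generic partner -/

section Embeddings

variable {F : Type u} [Field F]
variable (kk : Type u) {kk' : Type u} [Field kk] [Field kk'] [Algebra kk F] [Algebra kk' F]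
  (θ : kk ≃+* kk') {n : ℕ} (p : Fin n ⊕ Fin n → F) {z : Fin n ⊕ Fin n → F}

/-- The function field `kk(loc)` of the locus of `p` over `kk`. [folklore] -/
abbrev locFF : Type u := zeroLocusFunctionField (locIdeal kk p)

/-- **`Ψₚ : kk(loc) → F`**, the embedding onto `kk(p)` given by the point itself. [folklore] -/
def psiP : locFF kk p →ₐ[kk] F :=
  LocusComponents.liftOfIsGenericPt (locIdeal kk p) (isGenericPt_locIdeal kk p)

/-- `Ψₚ` on the generic point. [folklore] -/
@[simp] theorem psiP_genericPt (j : Fin n ⊕ Fin n) :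
    psiP kk p (genericPt (locIdeal kk p) j) = p j :=
  LocusComponents.liftOfIsGenericPt_genericPt _ _ j

/-- `Ψₚ` on scalars. [folklore] -/
@[simp] theorem psiP_algebraMap (y : kk) :
    psiP kk p (algebraMap kk (locFF kk p) y) = algebraMap kk F y :=
  (psiP kk p).commutes y

variable (hgen : IsGenericPt (LocusComponents.idealMapCoeff θ (locIdeal kk p)) z)

/-- **`Ψ : kk(loc) → F`**, the embedding through `θ : kk ≅ kk'` and a generic point `z` of
`loc^θ` over `kk'`. [cite: BaysKirby2018ANT, Def. 3.19] -/
def psi : locFF kk p →+* F :=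
  (LocusComponents.liftOfIsGenericPt _ hgen).toRingHom.comp
    (LocusComponents.funcFieldEquiv θ (locIdeal kk p)).toRingHom

/-- `Ψ` on the generic point. [folklore] -/
@[simp] theorem psi_genericPt (j : Fin n ⊕ Fin n) :
    psi kk θ p hgen (genericPt (locIdeal kk p) j) = z j := by
  simp [psi]

/-- `Ψ` on scalars is `θ`. [folklore] -/
@[simp] theorem psi_algebraMap (y : kk) :
    psi kk θ p hgen (algebraMap kk (locFF kk p) y) = algebraMap kk' F (θ y) := by
  simp only [psi, RingHom.coe_comp, Function.comp_apply, RingEquiv.toRingHom_eq_coe,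
    RingEquiv.coe_toRingHom, AlgHom.toRingHom_eq_coe, AlgHom.coe_toRingHom]
  rw [LocusComponents.funcFieldEquiv_algebraMap]
  exact (LocusComponents.liftOfIsGenericPt _ hgen).commutes _

/-- The subfield `kk(p) = Ψₚ(kk(loc))` of `F`. [folklore] -/
abbrev Rfld : Subfield F := (psiP kk p).toRingHom.fieldRange

/-- `kk(loc) ≃ kk(p)`. [folklore] -/
def eR : locFF kk p ≃+* Rfld kk p := (psiP kk p).toRingHom.rangeRestrictFieldEquiv

/-- **`ι : kk(p) → F`**, `Ψₚ y ↦ Ψ y`: the field embedding over `θ` sending `p ↦ z`.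
[cite: BaysKirby2018ANT, Def. 3.19] -/
def iota : Rfld kk p →+* F := (psi kk θ p hgen).comp (eR kk p).symm.toRingHom

/-- `ι (Ψₚ y) = Ψ y`. [folklore] -/
theorem iota_apply_psiP (y : locFF kk p) (h : psiP kk p y ∈ Rfld kk p) :
    iota kk θ p hgen ⟨psiP kk p y, h⟩ = psi kk θ p hgen y := by
  simp only [iota, RingHom.coe_comp, Function.comp_apply, RingEquiv.toRingHom_eq_coe,
    RingEquiv.coe_toRingHom]
  congr 1
  rw [RingEquiv.symm_apply_eq]
  exact Subtype.ext rfl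

/-- Scalars lie in `kk(p)`. [folklore] -/
theorem algebraMap_mem_Rfld (y : kk) : algebraMap kk F y ∈ Rfld kk p :=
  ⟨algebraMap kk (locFF kk p) y, psiP_algebraMap kk p y⟩

/-- `ι` is `θ` on scalars. [folklore] -/
theorem iota_algebraMap (y : kk) :
    iota kk θ p hgen ⟨algebraMap kk F y, algebraMap_mem_Rfld kk p y⟩ = algebraMap kk' F (θ y) := by
  have h := iota_apply_psiP kk θ p hgen (algebraMap kk (locFF kk p) y)
    (by rw [psiP_algebraMap]; exact algebraMap_mem_Rfld kk p y)
  rw [psi_algebraMap] at h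
  rw [← h]
  congr 1
  exact Subtype.ext (psiP_algebraMap kk p y).symm

/-- The coordinates of `p` lie in `kk(p)`. [folklore] -/
theorem apply_mem_Rfld (j : Fin n ⊕ Fin n) : p j ∈ Rfld kk p :=
  ⟨genericPt (locIdeal kk p) j, psiP_genericPt kk p j⟩

/-- `ι pⱼ = zⱼ`. [folklore] -/
theorem iota_apply_coord (j : Fin n ⊕ Fin n) :
    iota kk θ p hgen ⟨p j, apply_mem_Rfld kk p j⟩ = z j := by
  have h := iota_apply_psiP kk θ p hgen (genericPt (locIdeal kk p) j)
    (by rw [psiP_genericPt]; exact apply_mem_Rfld kk p j)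
  rw [psi_genericPt] at h
  rw [← h]
  congr 1
  exact Subtype.ext (psiP_genericPt kk p j).symm

/-- `N pⱼ ∈ kk(p)`. [folklore] -/
theorem natCast_mul_mem_Rfld (M : ℕ) (j : Fin n ⊕ Fin n) : (M : F) * p j ∈ Rfld kk p :=
  mul_mem (natCast_mem _ M) (apply_mem_Rfld kk p j)

/-- `ι (N pⱼ) = N zⱼ`. [folklore] -/
theorem iota_natCast_mul (M : ℕ) (j : Fin n ⊕ Fin n) :
    iota kk θ p hgen ⟨(M : F) * p j, natCast_mul_mem_Rfld kk p M j⟩ = (M : F) * z j := by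
  have h1 : (⟨(M : F) * p j, natCast_mul_mem_Rfld kk p M j⟩ : Rfld kk p) =
      (M : Rfld kk p) * ⟨p j, apply_mem_Rfld kk p j⟩ :=
    Subtype.ext (by simp)
  rw [h1, map_mul, map_natCast, iota_apply_coord]

end Embeddings

/-! ### Rational powers of exponentials -/

section RatPow

variable {F : Type*} [Field F] [CharZero F] [Literature.ModelTheory.ExponentialFields.ExponentialRing F]

/-- `exp (q • v) = exp (v / den q) ^ num q`. [folklore] -/
theorem exp_rat_smul_eq_zpow_den (q : ℚ) (v : F) :
    exp (q • v) = exp (v / (q.den : F)) ^ q.num := by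
  rw [← exp_zsmul, zsmul_eq_mul, Rat.smul_def, Rat.cast_def]
  congr 1
  ring

/-- If all `exp (v / d)`, `d ≥ 1`, lie in a subfield `L` then so does `exp (q • v)` for every
rational `q`. [folklore] -/
theorem exp_rat_smul_mem {L : Subfield F} {v : F} (h : ∀ d : ℕ, 0 < d → exp (v / (d : F)) ∈ L)
    (q : ℚ) : exp (q • v) ∈ L := by
  rw [exp_rat_smul_eq_zpow_den]
  exact zpow_mem (h q.den q.den_pos) _

/-- `exp` of the `ℚ`-span of a finite family lies in a subfield containing all `exp (wᵢ / d)`.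
[folklore] -/
theorem exp_mem_of_mem_span {L : Subfield F} {ι : Type*} [Fintype ι] {w : ι → F}
    (h : ∀ i (d : ℕ), 0 < d → exp (w i / (d : F)) ∈ L) {y : F}
    (hy : y ∈ Submodule.span ℚ (range w)) : exp y ∈ L := by
  obtain ⟨q, rfl⟩ := (Submodule.mem_span_range_iff_exists_fun ℚ).1 hy
  rw [exp_univ_sum]
  exact prod_mem fun i _ => exp_rat_smul_mem (h i) (q i)

end RatPow

/-! ### The core of the isomorphism step -/

section IsoCore

open Literature.FieldTheory.Kummer

variable {F : Type u} [Field F] [CharZero F] [Literature.ModelTheory.ExponentialFields.ExponentialRing F]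
variable (kk : Type u) {kk' : Type u} [Field kk] [Field kk'] [Algebra kk F] [Algebra kk' F]
  (θ : kk ≃+* kk') {k : ℕ} (a : Fin k → F) {x : Fin k → F}
  (hgen : IsGenericPt (LocusComponents.idealMapCoeff θ (locIdeal kk (gammaPt a))) (gammaPt x))
  (N : ℕ) {r : ℕ} (S : Set F) (b : Fin r → F)

/-- The tuple `exp a` (the "`m`-th division point" `c'` of the Kummer fact, `m = N`,
`c = exp (N a)`). [folklore] -/
abbrev expTuple (a : Fin k → F) : Fin k → F := fun j => exp (a j)

/-- The base field `L = ℚ(μ_∞ ∪ S ∪ exp a ∪ √b)` of the Kummer fact. [folklore] -/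
abbrev Lb (a : Fin k → F) (S : Set F) (b : Fin r → F) : Subfield F :=
  Literature.FieldTheory.Kummer.baseField (S ∪ range (expTuple a)) b

/-- The division system `exp (a / q)` below `exp a`. [folklore] -/
def rho (a : Fin k → F) : ℕ+ → Fin k → F := fun q j => exp (a j / (q : ℕ))

/-- `exp (a / q)` is a division system below `exp a`. [folklore] -/
theorem isDivisionSystem_rho (a : Fin k → F) : IsDivisionSystem (expTuple a) (rho a) := by
  refine ⟨?_, fun m q j => ?_⟩
  · funext j; simp [rho]
  · simp only [rho, PNat.mul_coe, Nat.cast_mul]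
    rw [← exp_nsmul, nsmul_eq_mul]
    congr 1
    have hq : ((q : ℕ) : F) ≠ 0 := Nat.cast_ne_zero.2 q.pos.ne'
    field_simp

variable {kk a N S b}

/-- **The Kummer conclusion, specialised** — an AUXILIARY PREDICATE, not a named fact: the inner
shape of `Literature.FieldTheory.Kummer.BaysKirby2018_divisionSequences_determined` (Bays–Kirby 2018, Prop. 3.22) after
`m = N` has been fixed and `c' = exp a` chosen; it is a hypothesis of `exists_ringHom_isoCore` and is
discharged from the named fact in `exists_isGammaIso_append_of_free`. [folklore] -/
def KummerConclusion (a : Fin k → F) (S : Set F) (b : Fin r → F) : Prop :=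
  ∀ ρ : ℕ+ → Fin k → F, IsDivisionSystem (expTuple a) ρ →
    ∀ (Ω₂ : Type u) [Field Ω₂] [Algebra (Lb a S b) Ω₂] (σ : ℕ+ → Fin k → Ω₂),
      IsDivisionSystem (fun j => algebraMap (Lb a S b) Ω₂ (baseTuple S b (expTuple a) j)) σ →
      RingHom.ker (MvPolynomial.aeval (fun q : ℕ+ × Fin k => ρ q.1 q.2) :
          MvPolynomial (ℕ+ × Fin k) (Lb a S b) →ₐ[Lb a S b] F) =
        RingHom.ker (MvPolynomial.aeval (fun q : ℕ+ × Fin k => σ q.1 q.2) :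
          MvPolynomial (ℕ+ × Fin k) (Lb a S b) →ₐ[Lb a S b] Ω₂)

include hgen in
set_option maxHeartbeats 1000000 in
/-- **The isomorphism step (core).** Data: a coefficient field `kk → F` (the Γ-field `A = ⟨K c⟩`),
an isomorphism `θ : kk ≅ kk'` onto another coefficient field (the Γ-isomorphism `A ≅ A'`), a
`ℚ`-subspace `X` (`= Γ₁(A)`), a tuple `a` with `(x, exp x)` a generic point of `θ(loc((a, exp a)/kk))`
over `kk'`, `N ≥ 1`, and the base field `L = ℚ(μ_∞ ∪ S ∪ exp a ∪ √b)` of the Kummer fact with: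
`L ⊆ kk((a, exp a))`, `X ∪ exp X ∪ kk ∪ {N aⱼ} ⊆ L`, `θ` compatible with `exp` on `X`, every element of
`X` and of `exp X` in the image of `kk`, and the Kummer conclusion for `(exp a, L)`. Then there is a
subfield `D ⊇ ℚ(Γ(X + ℚ(N a)))` of `F` and a ring homomorphism `Θ : D → F` which is `θ` on `kk`,
sends `N aⱼ ↦ N xⱼ`, and satisfies `Θ (exp y) = exp (Θ y)` for `y ∈ X + ℚ(N a)` — the embedding
"`C ≅ B` over `A`" of Bays–Kirby 2018, Lemma 8.3, obtained from "`c` is a good basis … by the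
definition of a good basis". Construction: the field embedding `ι : kk((a, exp a)) → F` over `θ`
with `(a, exp a) ↦ (x, exp x)` (genericity), the division systems `exp (a/q)` and `exp (x/q)`
below `exp a` and `ι (exp a) = exp x`, equality of their ideals over `L` (Kummer), whence a ring
homomorphism `L(exp (a/q) : q) → F` over `ι|_L` (`GammaField.pointFieldHom`).
[cite: BaysKirby2018ANT, Lemma 8.3 (proof), Def. 3.19, Prop. 3.22] -/
theorem exists_ringHom_isoCore (X : Submodule ℚ F)
    (hLR : Lb a S b ≤ Rfld kk (gammaPt a))
    (hXL : (X : Set F) ⊆ Lb a S b) (hexpXL : exp '' (X : Set F) ⊆ Lb a S b)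
    (hkkL : ∀ y : kk, algebraMap kk F y ∈ Lb a S b) (heL : ∀ j, (N : F) * a j ∈ Lb a S b)
    (hXkk : ∀ v ∈ X, ∃ y : kk, algebraMap kk F y = v)
    (hexpXkk : ∀ v ∈ X, ∃ y : kk, algebraMap kk F y = exp v)
    (hθexp : ∀ y₀ y₁ : kk, algebraMap kk F y₀ ∈ X → algebraMap kk F y₁ = exp (algebraMap kk F y₀) →
      algebraMap kk' F (θ y₁) = exp (algebraMap kk' F (θ y₀)))
    (hKum : KummerConclusion a S b) :
    ∃ (D : Subfield F) (Θ : D →+* F),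
      gens (X ⊔ Submodule.span ℚ (range fun j => (N : F) * a j)) ⊆ D ∧
      (∀ (y : kk) (h : algebraMap kk F y ∈ D), Θ ⟨algebraMap kk F y, h⟩ = algebraMap kk' F (θ y)) ∧
      (∀ (j : Fin k) (h : (N : F) * a j ∈ D), Θ ⟨(N : F) * a j, h⟩ = (N : F) * x j) ∧
      (∀ y ∈ X ⊔ Submodule.span ℚ (range fun j => (N : F) * a j), ∀ (h : y ∈ D) (h' : exp y ∈ D),
        Θ ⟨exp y, h'⟩ = exp (Θ ⟨y, h⟩)) := by
  classical
  set p := gammaPt a with hp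
  set e : Fin k → F := fun j => (N : F) * a j with he
  -- the embedding `ι` restricted to `L`
  set ι : Rfld kk p →+* F := iota kk θ p hgen with hι
  let ιL : Lb a S b →+* F := ι.comp (Subfield.inclusion hLR)
  have hιL : ∀ (y : F) (hy : y ∈ Lb a S b), ιL ⟨y, hy⟩ = ι ⟨y, hLR hy⟩ := fun _ _ => rfl
  -- the two division systems
  set ρ : ℕ+ → Fin k → F := rho a with hρ
  set σ' : ℕ+ → Fin k → F := rho x with hσ'
  have hρsys : IsDivisionSystem (expTuple a) ρ := isDivisionSystem_rho a
  -- `ι (exp aⱼ) = exp xⱼ`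
  have hιexp : ∀ j, ιL ⟨exp (a j), Subfield.subset_closure
      (Or.inl (Or.inr (Or.inr ⟨j, rfl⟩)))⟩ = exp (x j) := by
    intro j
    rw [hιL]
    have := iota_apply_coord kk θ p hgen (Sum.inr j)
    simp only [hp, gammaPt_inr] at this
    exact this
  -- Kummer, instantiated at the algebra structure `ιL` on `F`
  have hσsys : IsDivisionSystem
      (fun j => algebraMap (Lb a S b) (Twisted ιL) (baseTuple S b (expTuple a) j))
      (fun q j => Twisted.of ιL (σ' q j)) := by
    refine ⟨?_, fun m q j => ?_⟩
    · funext j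
      change rho x 1 j = ιL (baseTuple S b (expTuple a) j)
      have h1 : (baseTuple S b (expTuple a) j : Lb a S b) =
          ⟨exp (a j), Subfield.subset_closure (Or.inl (Or.inr (Or.inr ⟨j, rfl⟩)))⟩ := Subtype.ext rfl
      rw [h1, hιexp j]
      simp [rho]
    · exact (isDivisionSystem_rho x).2 m q j
  have hkerEq := hKum ρ hρsys (Twisted ιL) (fun q j => Twisted.of ιL (σ' q j)) hσsys
  rw [Twisted.ker_aeval_eq] at hkerEq
  -- the ring homomorphism `Ξ : L(ρ) → F`
  set E : IntermediateField (Lb a S b) F :=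
    IntermediateField.adjoin (Lb a S b) (range fun q : ℕ+ × Fin k => ρ q.1 q.2) with hE
  have hiff : ∀ P : MvPolynomial (ℕ+ × Fin k) (Lb a S b),
      aeval (fun q : ℕ+ × Fin k => ρ q.1 q.2) P = 0 ↔
        eval₂ ιL (fun q : ℕ+ × Fin k => σ' q.1 q.2) P = 0 := fun P => by
    have h := SetLike.ext_iff.1 hkerEq P
    rwa [RingHom.mem_ker, RingHom.mem_ker, coe_eval₂Hom] at h
  let Ξ := pointFieldHom ιL (fun q : ℕ+ × Fin k => ρ q.1 q.2) (fun q : ℕ+ × Fin k => σ' q.1 q.2) hiff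
  have hΞL : ∀ l : Lb a S b, Ξ (algebraMap (Lb a S b) E l) = ιL l :=
    pointFieldHom_algebraMap ιL _ _ hiff
  have hΞρ : ∀ i : ℕ+ × Fin k, Ξ ⟨ρ i.1 i.2, IntermediateField.subset_adjoin (Lb a S b) _ ⟨i, rfl⟩⟩ =
      σ' i.1 i.2 := fun i => pointFieldHom_apply_self ιL _ _ hiff i
  -- membership facts
  have hLE : ∀ y ∈ Lb a S b, y ∈ E := fun y hy => E.algebraMap_mem ⟨y, hy⟩
  have hρE : ∀ (q : ℕ+) j, ρ q j ∈ E := fun q j =>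
    IntermediateField.subset_adjoin (Lb a S b) _ ⟨(q, j), rfl⟩
  have hexpe_eq : ∀ (j : Fin k) (q : ℚ), exp (q • e j) = ρ ⟨q.den, q.den_pos⟩ j ^ ((N : ℤ) * q.num) := by
    intro j q
    rw [exp_rat_smul_eq_zpow_den]
    have h2 : exp (e j / (q.den : F)) = ρ ⟨q.den, q.den_pos⟩ j ^ (N : ℤ) := by
      simp only [he, hρ, rho, PNat.mk_coe, zpow_natCast]
      rw [← exp_nsmul, nsmul_eq_mul, mul_div_assoc]
    rw [h2, ← zpow_mul]
  have hexpeE : ∀ (j : Fin k) (q : ℚ), exp (q • e j) ∈ E := by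
    intro j q
    rw [hexpe_eq]
    exact zpow_mem (hρE _ j) _
  have hYE : ∀ y ∈ X ⊔ Submodule.span ℚ (range e), y ∈ E ∧ exp y ∈ E := by
    intro y hy
    obtain ⟨x₀, hx₀, v, hv, rfl⟩ := Submodule.mem_sup.1 hy
    obtain ⟨q, rfl⟩ := (Submodule.mem_span_range_iff_exists_fun ℚ).1 hv
    constructor
    · refine add_mem (hLE _ (hXL hx₀)) (sum_mem fun j _ => ?_)
      rw [Rat.smul_def]
      exact mul_mem (hLE _ (SubfieldClass.ratCast_mem (Lb a S b) (q j))) (hLE _ (heL j))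
    · rw [exp_add, exp_univ_sum]
      exact mul_mem (hLE _ (hexpXL ⟨x₀, hx₀, rfl⟩)) (prod_mem fun j _ => hexpeE j (q j))
  let Θ : E.toSubfield →+* F :=
    { toFun := fun y => Ξ ⟨y.1, y.2⟩
      map_one' := Ξ.map_one
      map_mul' := fun y y' => Ξ.map_mul ⟨y.1, y.2⟩ ⟨y'.1, y'.2⟩
      map_zero' := Ξ.map_zero
      map_add' := fun y y' => Ξ.map_add ⟨y.1, y.2⟩ ⟨y'.1, y'.2⟩ }
  refine ⟨E.toSubfield, Θ, ?_, ?_, ?_, ?_⟩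
  · -- `gens ⊆ E`
    rintro y (hy | ⟨v, hv, rfl⟩)
    · exact (hYE y hy).1
    · exact (hYE v hv).2
  · -- `Θ` on `kk`
    intro y h
    change Ξ ⟨algebraMap kk F y, h⟩ = _
    have h1 : (⟨algebraMap kk F y, h⟩ : E) = algebraMap (Lb a S b) E ⟨algebraMap kk F y, hkkL y⟩ :=
      Subtype.ext rfl
    rw [h1, hΞL, hιL]
    exact iota_algebraMap kk θ p hgen y
  · -- `Θ` on `N aⱼ`
    intro j h
    change Ξ ⟨(N : F) * a j, h⟩ = _
    have h1 : (⟨(N : F) * a j, h⟩ : E) = algebraMap (Lb a S b) E ⟨(N : F) * a j, heL j⟩ :=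
      Subtype.ext rfl
    rw [h1, hΞL, hιL]
    have := iota_natCast_mul kk θ p hgen N (Sum.inl j)
    simp only [hp, gammaPt_inl] at this
    exact this
  · -- `Θ (exp y) = exp (Θ y)` on `X + ℚe`
    intro y hy h h'
    change Ξ ⟨exp y, h'⟩ = exp (Ξ ⟨y, h⟩)
    obtain ⟨x₀, hx₀, v, hv, rfl⟩ := Submodule.mem_sup.1 hy
    obtain ⟨q, rfl⟩ := (Submodule.mem_span_range_iff_exists_fun ℚ).1 hv
    obtain ⟨y₀, hy₀⟩ := hXkk x₀ hx₀
    obtain ⟨y₁, hy₁⟩ := hexpXkk x₀ hx₀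
    -- values of `Ξ` on the pieces
    have hΞx₀ : Ξ ⟨x₀, hLE _ (hXL hx₀)⟩ = algebraMap kk' F (θ y₀) := by
      have h1 : (⟨x₀, hLE _ (hXL hx₀)⟩ : E) = algebraMap (Lb a S b) E ⟨algebraMap kk F y₀, hkkL y₀⟩ :=
        Subtype.ext hy₀.symm
      rw [h1, hΞL, hιL]
      exact iota_algebraMap kk θ p hgen y₀
    have hΞexpx₀ : Ξ ⟨exp x₀, hLE _ (hexpXL ⟨x₀, hx₀, rfl⟩)⟩ = exp (algebraMap kk' F (θ y₀)) := by
      have h1 : (⟨exp x₀, hLE _ (hexpXL ⟨x₀, hx₀, rfl⟩)⟩ : E) =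
          algebraMap (Lb a S b) E ⟨algebraMap kk F y₁, hkkL y₁⟩ := Subtype.ext hy₁.symm
      rw [h1, hΞL, hιL, iota_algebraMap kk θ p hgen y₁]
      exact hθexp y₀ y₁ (hy₀ ▸ hx₀) (hy₁.trans (by rw [hy₀]))
    have hΞe : ∀ j, Ξ ⟨e j, hLE _ (heL j)⟩ = (N : F) * x j := by
      intro j
      have h1 : (⟨e j, hLE _ (heL j)⟩ : E) = algebraMap (Lb a S b) E ⟨(N : F) * a j, heL j⟩ :=
        Subtype.ext rfl
      rw [h1, hΞL, hιL]
      have := iota_natCast_mul kk θ p hgen N (Sum.inl j)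
      simp only [hp, gammaPt_inl] at this
      exact this
    have hΞρ' : ∀ (d : ℕ+) j, Ξ ⟨ρ d j, hρE d j⟩ = σ' d j := fun d j => by
      have := hΞρ (d, j)
      exact this
    have hΞexpe : ∀ j, Ξ ⟨exp (q j • e j), hexpeE j (q j)⟩ = exp (q j • ((N : F) * x j)) := by
      intro j
      have h1 : (⟨exp (q j • e j), hexpeE j (q j)⟩ : E) =
          ⟨ρ ⟨(q j).den, (q j).den_pos⟩ j, hρE _ j⟩ ^ ((N : ℤ) * (q j).num) :=
        Subtype.ext (by push_cast; exact hexpe_eq j (q j))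
      rw [h1, map_zpow₀, hΞρ']
      -- the same computation on the `x` side
      rw [exp_rat_smul_eq_zpow_den]
      have h2 : exp ((N : F) * x j / ((q j).den : F)) = σ' ⟨(q j).den, (q j).den_pos⟩ j ^ (N : ℤ) := by
        simp only [hσ', rho, PNat.mk_coe, zpow_natCast]
        rw [← exp_nsmul, nsmul_eq_mul, mul_div_assoc]
      rw [h2, ← zpow_mul]
    -- decompose `y` and `exp y` inside `E`
    have hy1 : (⟨x₀ + ∑ j, q j • e j, h⟩ : E) =
        ⟨x₀, hLE _ (hXL hx₀)⟩ + ∑ j, ((q j : ℚ) : E) * ⟨e j, hLE _ (heL j)⟩ :=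
      Subtype.ext (by push_cast; simp [Rat.smul_def])
    have hy2 : (⟨exp (x₀ + ∑ j, q j • e j), h'⟩ : E) =
        ⟨exp x₀, hLE _ (hexpXL ⟨x₀, hx₀, rfl⟩)⟩ * ∏ j, ⟨exp (q j • e j), hexpeE j (q j)⟩ :=
      Subtype.ext (by push_cast; rw [exp_add, exp_univ_sum])
    rw [hy1, hy2, map_mul, map_prod, map_add, map_sum]
    simp only [map_mul, map_ratCast, hΞx₀, hΞexpx₀, hΞe, hΞexpe]
    rw [exp_add, exp_univ_sum]
    congr 1
    refine Finset.prod_congr rfl fun j _ => ?_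
    rw [Rat.smul_def]

end IsoCore

/-! ### Helpers for the assembly -/

section AssemblyHelpers

variable {F : Type*} [Field F] [CharZero F] [Literature.ModelTheory.ExponentialFields.ExponentialRing F]

/-- `fieldOf Λ ⊆ L` as soon as `gens Λ ⊆ L` (`L` a subfield, regarded as an intermediate field over
`ℚ` through `Subfield.toIntermediateField`). [folklore] -/
theorem fieldOf_subset_of_gens_subset {Λ : Submodule ℚ F} {L : Subfield F} (h : gens Λ ⊆ L) :
    ((fieldOf Λ : IntermediateField ℚ F) : Set F) ⊆ L := by
  have : fieldOf Λ ≤ L.toIntermediateField (fun q => by simp) := IntermediateField.adjoin_le_iff.2 h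
  exact fun y hy => this hy

omit [Literature.ModelTheory.ExponentialFields.ExponentialRing F] in
/-- Elements of the `ℚ`-span of a subset of a subfield lie in the subfield. [folklore] -/
theorem mem_subfield_of_mem_span {L : Subfield F} {s : Set F} (hs : s ⊆ L) {y : F}
    (hy : y ∈ Submodule.span ℚ s) : y ∈ L :=
  span_rat_le_subfield hs hy

omit [Field F] [CharZero F] [Literature.ModelTheory.ExponentialFields.ExponentialRing F] in
/-- `f ∘ Fin.append u e = Fin.append (f ∘ u) (f ∘ e)`. [folklore] -/
theorem comp_append {α : Type*} {r k : ℕ} (f : F → α) (u : Fin r → F) (e : Fin k → F) :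
    (fun i => f (Fin.append u e i)) = Fin.append (f ∘ u) (f ∘ e) := by
  funext i
  induction i using Fin.addCases with
  | left i => simp
  | right j => simp

omit [Literature.ModelTheory.ExponentialFields.ExponentialRing F] in
/-- `acl s` is closed under non-zero rational rescaling in both directions. [folklore] -/
theorem smul_mem_acl_iff {s : Set F} {q : ℚ} (hq : q ≠ 0) {y : F} : q • y ∈ acl s ↔ y ∈ acl s := by
  refine ⟨fun h => ?_, fun h => smul_mem_acl q h⟩
  have := smul_mem_acl q⁻¹ h
  rwa [smul_smul, inv_mul_cancel₀ hq, one_smul] at this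

end AssemblyHelpers

/-! ### The main case of the saturation theorem -/

section MainCase

open Literature.FieldTheory.Kummer

variable {F : Type u} [Field F] [CharZero F] [Literature.ModelTheory.ExponentialFields.ExponentialRing F]

set_option maxHeartbeats 800000 in
set_option synthInstance.maxHeartbeats 200000 in
/-- **`ℵ₀`-saturation for Γ-algebraic extensions, main case** (Bays–Kirby 2018, Lemma 8.3 (⟹), for
extensions `A ◁ B` with `A^full ∧ B = A`): let `F` be algebraically closed, strongly
exponentially-algebraically closed, with `ker exp = τℤ` (`τ ≠ 0`); let `ℚτ + ℚc ◁ F`, `ℚτ + ℚc' ◁ F`,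
`c ↦ c'` a Γ-isomorphism over `ℚτ`, and `e` a `k`-tuple linearly independent over `X = ℚτ + ℚc` with
`td(e/X) = k` (a basis of a Γ-algebraic extension) such that no non-trivial `ℤ`-combination of `e`,
nor its exponential, is algebraic over `ℚ(Γ(X))` (freeness of the locus: `A^full ∧ B = A`). Granted
the Kummer fact `Literature.FieldTheory.Kummer.BaysKirby2018_divisionSequences_determined`, there is `e'` with
`(c, e) ↦ (c', e')` a Γ-isomorphism over `ℚτ` and `ℚτ + ℚc' + ℚe' ◁ F`.
[cite: BaysKirby2018ANT, Lemma 8.3 (proof)] -/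
theorem exists_isGammaIso_append_of_free [IsAlgClosed F] (hSEAC : IsStronglyExpAlgClosed F)
    {τ : F} (hker : expKernel F = AddSubgroup.zmultiples τ) (hτ : τ ≠ 0)
    (hKfact : BaysKirby2018_divisionSequences_determined.{u})
    {N k : ℕ} {c c' : Fin N → F} {e : Fin k → F}
    (hX : IsStrong (Submodule.span ℚ {τ} ⊔ Submodule.span ℚ (range c)))
    (hX' : IsStrong (Submodule.span ℚ {τ} ⊔ Submodule.span ℚ (range c')))
    (hiso : IsGammaIso (Submodule.span ℚ {τ}) c c')
    (hlin : LinIndepOver (Submodule.span ℚ {τ} ⊔ Submodule.span ℚ (range c)) e)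
    (htd : td (Submodule.span ℚ {τ} ⊔ Submodule.span ℚ (range c)) (Submodule.span ℚ (range e)) = k)
    (hfree : ∀ m : Fin k → ℤ, m ≠ 0 →
      ∑ j, (m j : ℚ) • e j ∉ acl (gens (Submodule.span ℚ {τ} ⊔ Submodule.span ℚ (range c))) ∧
      exp (∑ j, (m j : ℚ) • e j) ∉ acl (gens (Submodule.span ℚ {τ} ⊔ Submodule.span ℚ (range c)))) :
    ∃ e' : Fin k → F, IsGammaIso (Submodule.span ℚ {τ}) (Fin.append c e) (Fin.append c' e') ∧
      IsStrong (Submodule.span ℚ {τ} ⊔ Submodule.span ℚ (range (Fin.append c' e'))) := by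
  classical
  set Λ₀ : Submodule ℚ F := Submodule.span ℚ {τ} with hΛ₀
  set X := Λ₀ ⊔ Submodule.span ℚ (range c) with hXdef
  set X' := Λ₀ ⊔ Submodule.span ℚ (range c') with hX'def
  have hτX : τ ∈ X := Submodule.mem_sup_left (Submodule.subset_span rfl)
  -- Step 1: a basis `u = c ∘ σ` of `X` modulo `ℚτ`
  obtain ⟨r, σ, hu, hspan⟩ := exists_linIndepOver_comp Λ₀ c
  set u : Fin r → F := c ∘ σ with hudef
  have hXu : X = Λ₀ ⊔ Submodule.span ℚ (range u) := by rw [hXdef, ← hspan]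
  -- Step 2: the Kummer fact
  set S : Set F := {τ} ∪ range c ∪ range e with hSdef
  have hSfin : S.Finite := ((finite_singleton τ).union (finite_range c)).union (finite_range e)
  set b : Fin r → F := fun l => exp (u l) with hbdef
  set cK : Fin k → F := fun j => exp (e j) with hcK
  have hb0 : ∀ l, b l ≠ 0 := fun l => exp_ne_zero _
  have hc0 : ∀ j, cK j ≠ 0 := fun j => exp_ne_zero _
  have hue : LinIndepOver Λ₀ (Fin.append u e) := hu.append (by rwa [← hXu])
  have hind : MulIndepModTorsion (Fin.append b cK) := by
    have : Fin.append b cK = fun i => exp (Fin.append u e i) := by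
      rw [comp_append]; rfl
    rw [this]
    exact mulIndepModTorsion_exp hker hue
  obtain ⟨m, hm, H⟩ := hKfact S hSfin b cK hb0 hc0 hind
  -- Step 3: the rescaled basis `a = e / m`
  have hm0 : (m : F) ≠ 0 := Nat.cast_ne_zero.2 hm.ne'
  set a : Fin k → F := fun j => e j / (m : F) with hadef
  have hea : ∀ j, (m : F) * a j = e j := fun j => by simp only [hadef]; field_simp
  have hea' : (fun j => (m : F) * a j) = e := funext hea
  have haq : a = fun j => ((m : ℚ)⁻¹) • e j := by
    funext j; simp only [hadef]; exact div_natCast_eq_smul (e j) m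
  have ha : LinIndepOver X a := by
    rw [haq]; exact hlin.smul (inv_ne_zero (Nat.cast_ne_zero.2 hm.ne'))
  have hspan_a : Submodule.span ℚ (range a) = Submodule.span ℚ (range e) := by
    apply le_antisymm
    · refine Submodule.span_le.2 ?_
      rintro _ ⟨j, rfl⟩
      rw [haq]
      exact Submodule.smul_mem _ _ (Submodule.subset_span ⟨j, rfl⟩)
    · refine Submodule.span_le.2 ?_
      rintro _ ⟨j, rfl⟩
      rw [← hea j, ← nsmul_eq_mul]
      exact Submodule.smul_of_tower_mem _ m (Submodule.subset_span ⟨j, rfl⟩)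
  have htda : td X (Submodule.span ℚ (range a)) = k := by rw [hspan_a]; exact htd
  have hfreea : ∀ n : Fin k → ℤ, n ≠ 0 →
      ∑ j, (n j : ℚ) • a j ∉ acl (gens X) ∧ exp (∑ j, (n j : ℚ) • a j) ∉ acl (gens X) := by
    intro n hn
    have hsum : ∑ j, (n j : ℚ) • a j = ((m : ℚ)⁻¹) • ∑ j, (n j : ℚ) • e j := by
      rw [Finset.smul_sum]
      refine Finset.sum_congr rfl fun j _ => ?_
      rw [haq, smul_comm]
    rw [hsum, smul_mem_acl_iff (inv_ne_zero (Nat.cast_ne_zero.2 hm.ne'))]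
    refine ⟨(hfree n hn).1, fun h => (hfree n hn).2 ?_⟩
    -- `exp (∑ n e) = (exp (m⁻¹ ∑ n e)) ^ m`
    have : exp (∑ j, (n j : ℚ) • e j) = exp (((m : ℚ)⁻¹) • ∑ j, (n j : ℚ) • e j) ^ m := by
      rw [← exp_nsmul, ← Nat.cast_smul_eq_nsmul ℚ, smul_smul, mul_inv_cancel₀
        (Nat.cast_ne_zero.2 hm.ne'), one_smul]
    rw [this]
    obtain ⟨A, hA, -⟩ := exists_subalgebra_eq_acl (gens X)
    rw [← hA] at h ⊢
    exact pow_mem h m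
  have hKum : KummerConclusion a S b := by
    intro ρ hρ Ω₂ _ _ σσ hσσ
    exact H (expTuple a) (fun j => by
      change exp (a j) ^ m = exp (e j)
      rw [← exp_nsmul, nsmul_eq_mul, hea]) ρ hρ Ω₂ σσ hσσ
  -- Step 4: the generic partner on the `c'` side
  set T : Finset F := insert τ (Finset.univ.image c') with hTdef
  have hT : Submodule.span ℚ (↑T : Set F) = X' := by
    rw [hTdef, Finset.coe_insert, Finset.coe_image, Finset.coe_univ, Set.image_univ,
      Submodule.span_insert]
  obtain ⟨x, hgen, hlinx, htdx⟩ :=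
    exists_generic_partner Λ₀ hiso a hSEAC hX hX' ha htda hfreea T hT
  -- Step 5: the isomorphism step
  set kk : IntermediateField (fieldOf Λ₀) F := bfld Λ₀ c with hkk
  set kk' : IntermediateField (fieldOf Λ₀) F := bfld Λ₀ c' with hkk'
  set θ := hiso.fieldEquiv with hθ
  -- membership: `fieldOf X ⊆ Rfld`, `exp X ⊆ L`, ...
  have hfX_R : ∀ y ∈ fieldOf X, y ∈ Rfld kk (gammaPt a) := fun y hy =>
    algebraMap_mem_Rfld kk (gammaPt a) ⟨y, (mem_adjoinField_allGens_iff Λ₀ c).2 hy⟩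
  have hrootsL : ∀ (d : ℕ), 0 < d → exp (τ / (d : F)) ∈ Lb a S b := by
    intro d hd
    refine Literature.FieldTheory.Kummer.mem_baseField_of_mem_allRoots_one _ ⟨d, hd, ?_⟩
    rw [← exp_nsmul, nsmul_eq_mul, mul_div_cancel₀ _ (Nat.cast_ne_zero.2 hd.ne'), exp_tau_eq_one hker]
  have hurootsL : ∀ (l : Fin r) (d : ℕ), 0 < d → exp (u l / (d : F)) ∈ Lb a S b := by
    intro l d hd
    refine Literature.FieldTheory.Kummer.mem_baseField_of_mem_allRoots _ l ⟨d, hd, ?_⟩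
    rw [← exp_nsmul, nsmul_eq_mul, mul_div_cancel₀ _ (Nat.cast_ne_zero.2 hd.ne')]
  have hexpX_L : ∀ y ∈ X, exp y ∈ Lb a S b := by
    intro y hy
    rw [hXu] at hy
    obtain ⟨y₀, hy₀, y₁, hy₁, rfl⟩ := Submodule.mem_sup.1 hy
    rw [exp_add]
    refine mul_mem ?_ (exp_mem_of_mem_span hurootsL hy₁)
    rw [hΛ₀] at hy₀
    have hy₀' : y₀ ∈ Submodule.span ℚ (range ![τ]) := by simpa using hy₀
    exact exp_mem_of_mem_span (w := ![τ]) (fun i d hd => by simpa using hrootsL d hd) hy₀'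
  have hS_L : S ⊆ Lb a S b := fun y hy => Literature.FieldTheory.Kummer.mem_baseField_of_mem _ (Or.inl hy)
  have hX_L : (X : Set F) ⊆ Lb a S b := by
    intro y hy
    have hy' : y ∈ Submodule.span ℚ ({τ} ∪ range c) := by
      rw [Submodule.span_union]; exact hy
    exact mem_subfield_of_mem_span (fun z hz => hS_L (Or.inl hz)) hy'
  have hgensX_L : gens X ⊆ Lb a S b := by
    rintro y (hy | ⟨v, hv, rfl⟩)
    · exact hX_L hy
    · exact hexpX_L v hv
  have hfX_L : ∀ y ∈ fieldOf X, y ∈ Lb a S b := fun y hy =>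
    fieldOf_subset_of_gens_subset hgensX_L hy
  have hLR : Lb a S b ≤ Rfld kk (gammaPt a) := by
    refine Subfield.closure_le.2 ?_
    rintro y ((h1 | hS') | hbr)
    · -- roots of unity
      obtain ⟨v, hv, rfl⟩ := allRoots_one_subset hker hτ hτX h1
      exact hfX_R _ (exp_mem_fieldOf hv)
    · rcases hS' with hS'' | ⟨j, rfl⟩
      · rcases hS'' with (hτ' | ⟨i, rfl⟩) | ⟨j, rfl⟩
        · rw [mem_singleton_iff.1 hτ']
          exact hfX_R _ (mem_fieldOf_of_mem hτX)
        · exact hfX_R _ (mem_fieldOf_of_mem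
            (Submodule.mem_sup_right (Submodule.subset_span ⟨i, rfl⟩)))
        · rw [← hea j]
          exact natCast_mul_mem_Rfld kk (gammaPt a) m (Sum.inl j)
      · exact apply_mem_Rfld kk (gammaPt a) (Sum.inr j)
    · obtain ⟨l, hl⟩ := mem_iUnion.1 hbr
      obtain ⟨v, hv, rfl⟩ := allRoots_exp_subset hker hτ hτX
        (show u l ∈ X from by rw [hXu]; exact Submodule.mem_sup_right (Submodule.subset_span ⟨l, rfl⟩)) hl
      exact hfX_R _ (exp_mem_fieldOf hv)
  have hkkL : ∀ y : kk, algebraMap kk F y ∈ Lb a S b := fun y =>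
    hfX_L _ ((mem_adjoinField_allGens_iff Λ₀ c).1 y.2)
  have heL : ∀ j, (m : F) * a j ∈ Lb a S b := fun j => by
    rw [hea j]; exact hS_L (Or.inr ⟨j, rfl⟩)
  have hXkk : ∀ v ∈ X, ∃ y : kk, algebraMap kk F y = v := fun v hv =>
    ⟨⟨v, (mem_adjoinField_allGens_iff Λ₀ c).2 (mem_fieldOf_of_mem hv)⟩, rfl⟩
  have hexpXkk : ∀ v ∈ X, ∃ y : kk, algebraMap kk F y = exp v := fun v hv =>
    ⟨⟨exp v, (mem_adjoinField_allGens_iff Λ₀ c).2 (exp_mem_fieldOf hv)⟩, rfl⟩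
  have hθexp : ∀ y₀ y₁ : kk, algebraMap kk F y₀ ∈ X →
      algebraMap kk F y₁ = exp (algebraMap kk F y₀) →
      algebraMap kk' F (θ y₁) = exp (algebraMap kk' F (θ y₀)) := by
    rintro ⟨v₀, hv₀⟩ ⟨v₁, hv₁⟩ hy₀ hy₁
    change v₀ ∈ X at hy₀
    change v₁ = exp v₀ at hy₁
    subst hy₁
    exact (hiso.fieldEquiv_exp hy₀).2
  obtain ⟨D, Θ, hgensD, hΘkk, hΘe, hΘexp⟩ := exists_ringHom_isoCore θ hgen X hLR hX_L
    (by rintro _ ⟨v, hv, rfl⟩; exact hexpX_L v hv) hkkL heL hXkk hexpXkk hθexp hKum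
  rw [hea'] at hgensD hΘexp
  -- Step 6: the ring homomorphism on `⟨ℚτ, c, e⟩`
  set e' : Fin k → F := fun j => (m : F) * x j with he'
  have hY : Λ₀ ⊔ Submodule.span ℚ (range (Fin.append c e)) = X ⊔ Submodule.span ℚ (range e) := by
    rw [ZilberHomogeneity.range_append, Submodule.span_union, hXdef, sup_assoc]
  have hY' : Λ₀ ⊔ Submodule.span ℚ (range (Fin.append c' e')) = X' ⊔ Submodule.span ℚ (range e') := by
    rw [ZilberHomogeneity.range_append, Submodule.span_union, hX'def, sup_assoc]
  set E₂ : IntermediateField (fieldOf Λ₀) F :=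
    IntermediateField.adjoin (fieldOf Λ₀) (allGens (Fin.append c e)) with hE₂
  have hE₂D : ∀ y ∈ E₂, y ∈ D := by
    intro y hy
    have hy' : y ∈ fieldOf (X ⊔ Submodule.span ℚ (range e)) := by
      rw [← hY]; exact (mem_adjoinField_allGens_iff Λ₀ (Fin.append c e)).1 hy
    exact fieldOf_subset_of_gens_subset hgensD hy'
  let Θ' : E₂ →+* F :=
    { toFun := fun y => Θ ⟨y.1, hE₂D y.1 y.2⟩
      map_one' := Θ.map_one
      map_mul' := fun y y' => Θ.map_mul ⟨y.1, hE₂D y.1 y.2⟩ ⟨y'.1, hE₂D y'.1 y'.2⟩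
      map_zero' := Θ.map_zero
      map_add' := fun y y' => Θ.map_add ⟨y.1, hE₂D y.1 y.2⟩ ⟨y'.1, hE₂D y'.1 y'.2⟩ }
  have hΘ' : ∀ (y : F) (hy : y ∈ E₂), Θ' ⟨y, hy⟩ = Θ ⟨y, hE₂D y hy⟩ := fun _ _ => rfl
  -- values of `Θ'` on `⟨K c⟩`
  have hΘ'kk : ∀ (y : F) (hy : y ∈ kk) (hy' : y ∈ E₂), Θ' ⟨y, hy'⟩ = (θ ⟨y, hy⟩ : F) := by
    intro y hy hy'
    rw [hΘ']
    exact hΘkk ⟨y, hy⟩ (hE₂D y hy')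
  -- Step 7: the Γ-isomorphism
  have hisoY : IsGammaIso Λ₀ (Fin.append c e) (Fin.append c' e') := by
    refine isGammaIso_of_ringHom Θ' (fun κ => ?_) (fun i => ?_) (fun y hy => ?_)
    · -- identity on `K₀`
      have hκ : (κ : F) ∈ kk := (bfld Λ₀ c).algebraMap_mem κ
      rw [hΘ'kk _ hκ]
      exact hiso.coe_fieldEquiv_algebraMap κ
    · -- generators
      induction i using Fin.addCases with
      | left i =>
        have hci : c i ∈ kk := mem_adjoinField_of_mem_adjoin
          (lvAlgebra_le_adjoin_allGens Λ₀ 0 c (lvGens_mem_lvAlgebra Λ₀ 0 c (Sum.inl i)))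
        simp only [Fin.append_left]
        rw [hΘ'kk _ hci]
        have := hiso.coe_fieldEquiv_lvGens 0 (Sum.inl i)
        simpa using this
      | right j =>
        simp only [Fin.append_right]
        rw [hΘ']
        have key : ∀ (h : e j ∈ D), Θ ⟨e j, h⟩ = (m : F) * x j := by
          intro h
          have h' : (m : F) * a j ∈ D := by rw [hea j]; exact h
          have hsub : (⟨e j, h⟩ : D) = ⟨(m : F) * a j, h'⟩ := Subtype.ext (hea j).symm
          rw [hsub]
          exact hΘe j h'
        exact key _
    · -- compatibility with `exp`
      rw [hΘ', hΘ']
      rw [hY] at hy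
      exact hΘexp y hy _ _
  -- Step 8: strongness of `ℚτ + ℚc' + ℚe'`
  refine ⟨e', hisoY, ?_⟩
  rw [hY']
  have hspan_e' : Submodule.span ℚ (range e') = Submodule.span ℚ (range x) := by
    apply le_antisymm
    · refine Submodule.span_le.2 ?_
      rintro _ ⟨j, rfl⟩
      change (m : F) * x j ∈ Submodule.span ℚ (range x)
      rw [← nsmul_eq_mul]
      exact Submodule.smul_of_tower_mem _ m (Submodule.subset_span ⟨j, rfl⟩)
    · refine Submodule.span_le.2 ?_
      rintro _ ⟨j, rfl⟩
      have : x j = ((m : ℚ)⁻¹) • e' j := by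
        change x j = ((m : ℚ)⁻¹) • ((m : F) * x j)
        rw [← div_natCast_eq_smul]; field_simp
      rw [this]
      exact Submodule.smul_mem _ _ (Submodule.subset_span ⟨j, rfl⟩)
  rw [hspan_e']
  have hfg : IsFG X' (Submodule.span ℚ (range x)) := isFG_span_of_finite X' (finite_range x)
  refine hX'.of_predim_eq_zero le_sup_left (isFG_sup_left.2 hfg) ?_
  rw [predim_sup_left, predim_def, ldim_span_eq_of_linIndepOver hlinx, htdx]
  simp

end MainCase

end ZilberSaturationMain

end Literature.NumberTheory.Transcendental
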